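import Literature.NumberTheory.LFunctions.LargeValuesS3Localisation
import Literature.NumberTheory.LFunctions.LargeValuesAffineSums
import Literature.NumberTheory.LFunctions.LargeValuesEnergyBound
import Mathlib.MeasureTheory.Function.JacobianOneDim
import HarnessLib

/-!
# Guth–Maynard Proposition 10.1 (the refined `S₃` bound) and the discharge of `zeroDensity_guth_maynard`

Topic `NumberTheory/LFunctions`, family RH. The last file of the programme around the tree's named
fact `Literature.NumberTheory.LFunctions.zeroDensity_guth_maynard` (L. Guth, J. Maynard, *New large
value estimates for Dirichlet polynomials*, Ann. of Math. 203 (2026)): `N(σ,T) ≪ T^{15(1−σ)/(3+5σ)+o(1)}`.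
The tree already reduces the fact to Proposition 10.1 of the paper
(`GuthMaynardEnergyBound.zeroDensity_guth_maynard_of_S3`: §§3–6, 11–13 and Proposition 11.1 are
proved there). Here we PROVE Proposition 10.1,

  `S₃ ≤ C N^δ (T²|W|^{3/2} + TN|W|^{1/2}E(W)^{1/2})` (`T = N^{6/5}`, `W ⊂ [t₀, t₀+T]` `T^ε`-separated),

in two parts.

**Part A (namespace `GuthMaynardS3Blocks`), the dyadic blocks of `∑_m |I_m|` and their reduction to `J(f_B)`:**
* §A2 the negligible blocks: if `|θ| ≥ NΘ` on the box then `ImMajorant ≤ (9/4)D N³|W|³(1+Θ)^{-j}`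
  (`majorant_le_of_theta_ge`), and `|θ| ≥ N` when `i₃ ≥ max(i₁,i₂) + 5` (`majorant_le_of_far_block`);
* §A3 Cauchy–Schwarz over a block ("`S₃,₀ ≤ (N²/M)S₃,₁^{1/2}S₃,₂^{1/2}` … `S₃,₂ ≪ S₃,₃^{1/2}S₃,₄^{1/2}`"):
  `∫_{[1/2,2]} |R| ∑_m f_B(A_m)^{1/2}f_B(B_m)^{1/2} ≤ (∫|R|²)^{1/2} (∫(∑f_B(A_m))²)^{1/4} (∫(∑ f_B(B_m))²)^{1/4}`;
* §A4 `S₃,₄ ≤ J(f_B; I₁, I₂, ·)` and, after `u = 1/v`, `S₃,₃ ≤ 4J(f_B; I₃, I₂, ·)`;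
* §A5 the bound for one block `∑_{m ∈ shell i₁ × shell i₂ × shell i₃} |I_m|` (`block_sum_le_snd/_fst`).

**Part B (namespace `GuthMaynardS3Final`), the assembly:** `f_B` is admissible for Proposition 9.1
(support for `B ≥ 48`, Fourier decay by Lemma 8.4), the arithmetic of one main block (`main_block_alg`,
`main_block`: Proposition 9.1 + `∫g_W ≪ |W|`, `∫g_W² ≪ N^η E(W) + negligible`), the count of dyadic
scales (`card_range_log_le`, `card_blocks_le`), the truncation `S₃ = ∑_{m∈𝓜³} I_m + O(T²|W|^{3/2})`
(`trunc_total`), the bound for every dyadic block (`block_bound`) and **Proposition 10.1** (`S3_bound`,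
in the exact form of the hypothesis of `zeroDensity_guth_maynard_of_S3`). Finally
**`zeroDensity_guth_maynard_holds : zeroDensity_guth_maynard`**.

No definition and no named fact is introduced; everything in this file is proved.

## References

* L. Guth, J. Maynard, *New large value estimates for Dirichlet polynomials*, Ann. of Math. (2)
  203 (2026), no. 2; arXiv:2405.20552 (2024): §7 (Proposition 7.2), §10 (Proposition 10.1 and its
  proof), Theorem 1.2.
-/

noncomputable section

open Finset hiding addEnergy
open Real Set Filter Topology Complex MeasureTheory
open scoped FourierTransform ContDiff Convolution

namespace Literature.NumberTheory.LFunctions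


namespace GuthMaynardS3Blocks

open GuthMaynardFourier GuthMaynardRFunction GuthMaynardS3 GuthMaynardSmoothR GuthMaynardS3Loc
  GuthMaynardAffine

/-! ## §2. Negligible blocks -/

/-- **A uniform lower bound for `|θ|` on the box makes the majorant small**:
`ImMajorant D j N W m ≤ N³ · (9/4)|W|³ D (1+Θ)^{-j}` if `|θ(v₁,v)| ≥ Θ` for `v₁, v ∈ [1/2,2]`.
[cite: GuthMaynard2026, proof of Proposition 7.2 ("the integral is `O(T^{-100})` unless …")] -/
theorem majorant_le_of_theta_ge {D : ℝ} (hD : 0 ≤ D) (j : ℕ) (N : ℕ) (W : Finset ℝ) (m : ℤ × ℤ × ℤ)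
    {Θ : ℝ} (hΘ : 0 ≤ Θ)
    (h : ∀ v₁ ∈ Set.Icc (1 / 2 : ℝ) 2, ∀ v ∈ Set.Icc (1 / 2 : ℝ) 2, Θ ≤ |theta N m v₁ v|) :
    ImMajorant D j N W m ≤ (N : ℝ) ^ 3 * (9 / 4 * (W.card : ℝ) ^ 3 * (D / (1 + Θ) ^ j)) := by
  unfold ImMajorant
  refine mul_le_mul_of_nonneg_left ?_ (by positivity)
  set I : Set ℝ := Set.Icc (1 / 2 : ℝ) 2 with hI
  set K : ℝ := (W.card : ℝ) with hK
  set F : ℝ → ℝ → ℝ := fun v₁ v ↦ ‖Rfun W v₁‖ * ‖Rfun W (v / v₁)‖ * ‖Rfun W v‖ * (D / (1 + |theta N m v₁ v|) ^ j)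
    with hF
  have hIfin : volume I < ⊤ := by rw [hI, Real.volume_Icc]; exact ENNReal.ofReal_lt_top
  have hIreal : (volume : Measure ℝ).real I = 3 / 2 := by
    rw [hI, Real.volume_real_Icc_of_le (by norm_num)]; norm_num
  have hF0 : ∀ v₁ v, 0 ≤ F v₁ v := fun v₁ v ↦ by simp only [hF]; positivity
  -- inner bound
  have hinner : ∀ v₁ ∈ I, ∫ v in I, F v₁ v ≤ 3 / 2 * (K ^ 3 * (D / (1 + Θ) ^ j)) := by
    intro v₁ hv₁
    have hb : ∀ v ∈ I, ‖F v₁ v‖ ≤ K ^ 3 * (D / (1 + Θ) ^ j) := by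
      intro v hv
      rw [Real.norm_of_nonneg (hF0 v₁ v)]
      have h1 := norm_Rfun_le W v₁
      have h2 := norm_Rfun_le W (v / v₁)
      have h3 := norm_Rfun_le W v
      have h4 : D / (1 + |theta N m v₁ v|) ^ j ≤ D / (1 + Θ) ^ j :=
        div_le_div_of_nonneg_left hD (by positivity) (pow_le_pow_left₀ (by positivity) (by linarith [h v₁ hv₁ v hv]) j)
      calc F v₁ v ≤ K * K * K * (D / (1 + Θ) ^ j) := by
            simp only [hF]; gcongr
        _ = _ := by ring
    have := norm_setIntegral_le_of_norm_le_const hIfin hb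
    rw [hIreal] at this
    calc ∫ v in I, F v₁ v ≤ ‖∫ v in I, F v₁ v‖ := Real.le_norm_self _
      _ ≤ K ^ 3 * (D / (1 + Θ) ^ j) * (3 / 2) := this
      _ = _ := by ring
  have hLint : IntegrableOn (fun v₁ ↦ ∫ v in I, F v₁ v) I :=
    (majorantIntegrand_integrable hD j N W m).integral_prod_left
  calc ∫ v₁ in I, ∫ v in I, F v₁ v ≤ ∫ v₁ in I, (3 / 2 * (K ^ 3 * (D / (1 + Θ) ^ j)) : ℝ) :=
        setIntegral_mono_on hLint (integrableOn_const hIfin.ne) measurableSet_Icc hinner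
    _ = 3 / 2 * (3 / 2 * (K ^ 3 * (D / (1 + Θ) ^ j))) := by rw [setIntegral_const, hIreal, smul_eq_mul]
    _ = _ := by ring

/-- `|θ| ≥ NX` on the box if `|m₃| ≥ 4|m₁| + 4|m₂| + X`. [cite: GuthMaynard2026, proof of Proposition 7.2] -/
theorem theta_ge_of_m3_large (N : ℕ) (m : ℤ × ℤ × ℤ) {X : ℝ}
    (_hX : 4 * |(m.1 : ℝ)| + 4 * |(m.2.1 : ℝ)| + X ≤ |(m.2.2 : ℝ)|)
    {v₁ v : ℝ} (hv₁ : v₁ ∈ Set.Icc (1 / 2 : ℝ) 2) (hv : v ∈ Set.Icc (1 / 2 : ℝ) 2) :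
    (N : ℝ) * X ≤ |theta N m v₁ v| := by
  rw [theta, abs_mul, Nat.abs_cast]
  refine mul_le_mul_of_nonneg_left ?_ (Nat.cast_nonneg _)
  have h1 : |(m.1 : ℝ) * v₁| ≤ 2 * |(m.1 : ℝ)| := by
    rw [abs_mul, abs_of_nonneg (by linarith [hv₁.1] : (0:ℝ) ≤ v₁)]
    nlinarith [abs_nonneg (m.1 : ℝ), hv₁.2]
  have h2 : |(m.2.1 : ℝ) * v| ≤ 2 * |(m.2.1 : ℝ)| := by
    rw [abs_mul, abs_of_nonneg (by linarith [hv.1] : (0:ℝ) ≤ v)]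
    nlinarith [abs_nonneg (m.2.1 : ℝ), hv.2]
  have h3 : |(m.2.2 : ℝ)| - |(m.1 : ℝ) * v₁ + (m.2.1 : ℝ) * v| ≤ |(m.1 : ℝ) * v₁ + (m.2.1 : ℝ) * v + m.2.2| := by
    have := abs_sub_abs_le_abs_sub (m.2.2 : ℝ) (-((m.1 : ℝ) * v₁ + (m.2.1 : ℝ) * v))
    rw [abs_neg, sub_neg_eq_add] at this
    calc _ ≤ |(m.2.2 : ℝ) + ((m.1 : ℝ) * v₁ + (m.2.1 : ℝ) * v)| := this
      _ = _ := by congr 1; ring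
  have h4 := abs_add_le ((m.1 : ℝ) * v₁) ((m.2.1 : ℝ) * v)
  linarith [abs_nonneg (m.1 : ℝ), abs_nonneg (m.2.1 : ℝ)]

/-- **Negligible blocks**: if `i₃ ≥ max(i₁,i₂) + 5` then `|θ| ≥ N` on the box for every `m` in the block,
so `|I_m| ≤ ImMajorant ≤ (9/4)D N³|W|³(1+N)^{-j}`. [cite: GuthMaynard2026, proof of Proposition 7.2] -/
theorem majorant_le_of_far_block {D : ℝ} (hD : 0 ≤ D) (j : ℕ) (N : ℕ) (W : Finset ℝ) {M₀ i₁ i₂ i₃ : ℕ}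
    (hfar : max i₁ i₂ + 5 ≤ i₃) {m : ℤ × ℤ × ℤ} (hm : m ∈ shell M₀ i₁ ×ˢ (shell M₀ i₂ ×ˢ shell M₀ i₃)) :
    ImMajorant D j N W m ≤ (N : ℝ) ^ 3 * (9 / 4 * (W.card : ℝ) ^ 3 * (D / (1 + (N : ℝ)) ^ j)) := by
  simp only [Finset.mem_product] at hm
  obtain ⟨h1, h2, h3⟩ := hm
  have b1 := shell_bounds h1
  have b2 := shell_bounds h2
  have b3 := shell_bounds h3
  set mx := max i₁ i₂ with hmx
  have hp1 : (2 : ℝ) ^ i₁ ≤ 2 ^ mx := pow_le_pow_right₀ (by norm_num) (le_max_left _ _)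
  have hp2 : (2 : ℝ) ^ i₂ ≤ 2 ^ mx := pow_le_pow_right₀ (by norm_num) (le_max_right _ _)
  have hp3 : (2 : ℝ) ^ (mx + 5) ≤ 2 ^ i₃ := pow_le_pow_right₀ (by norm_num) hfar
  have hX : 4 * |(m.1 : ℝ)| + 4 * |(m.2.1 : ℝ)| + 1 ≤ |(m.2.2 : ℝ)| := by
    have : (2 : ℝ) ^ (mx + 5) = 32 * 2 ^ mx := by rw [pow_add]; ring
    have hmx1 : (1 : ℝ) ≤ 2 ^ mx := one_le_pow₀ (by norm_num)
    linarith [b1.2, b2.2, b3.1]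
  have h := majorant_le_of_theta_ge hD j N W m (Nat.cast_nonneg N) fun v₁ hv₁ v hv ↦ by
    have := theta_ge_of_m3_large N m hX hv₁ hv
    simpa using this
  exact h

/-! ## §3. Cauchy–Schwarz over a block -/

section CS

/-- Continuous functions on `[1/2,2]` are in `L²` of the restricted measure. [folklore] -/
theorem memLp_two_of_continuousOn {f : ℝ → ℝ} (hf : ContinuousOn f (Set.Icc (1 / 2 : ℝ) 2)) :
    MemLp f (ENNReal.ofReal 2) ((volume : Measure ℝ).restrict (Set.Icc (1 / 2 : ℝ) 2)) := by
  haveI : IsFiniteMeasure ((volume : Measure ℝ).restrict (Set.Icc (1 / 2 : ℝ) 2)) :=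
    ⟨by rw [Measure.restrict_apply_univ, Real.volume_Icc]; exact ENNReal.ofReal_lt_top⟩
  obtain ⟨C, hC⟩ := isCompact_Icc.exists_bound_of_continuousOn hf
  refine MemLp.of_bound (hf.aestronglyMeasurable measurableSet_Icc) C ?_
  exact (ae_restrict_mem measurableSet_Icc).mono fun x hx ↦ hC x hx

/-- **Cauchy–Schwarz over a block** ("By Cauchy–Schwarz we have `S₃,₀ ≤ (N²/M)S₃,₁^{1/2}S₃,₂^{1/2}` … and
`S₃,₂ ≪ S₃,₃^{1/2} S₃,₄^{1/2}`"): for `r, A_m, B_m ≥ 0` continuous on `[1/2,2]`,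
`∫ r ∑_m A_m^{1/2}B_m^{1/2} ≤ (∫ r²)^{1/2} (∫ (∑A_m)²)^{1/4} (∫ (∑B_m)²)^{1/4}` (integrals over `[1/2,2]`).
[cite: GuthMaynard2026, proof of Proposition 10.1] -/
theorem setIntegral_sum_sqrt_mul_le {ι : Type*} (S : Finset ι) {r : ℝ → ℝ} {A B : ι → ℝ → ℝ}
    (hr : ContinuousOn r (Set.Icc (1 / 2 : ℝ) 2)) (hr0 : ∀ v, 0 ≤ r v)
    (hA : ∀ m ∈ S, ContinuousOn (A m) (Set.Icc (1 / 2 : ℝ) 2)) (hA0 : ∀ m ∈ S, ∀ v, 0 ≤ A m v)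
    (hB : ∀ m ∈ S, ContinuousOn (B m) (Set.Icc (1 / 2 : ℝ) 2)) (hB0 : ∀ m ∈ S, ∀ v, 0 ≤ B m v) :
    ∫ v in Set.Icc (1 / 2 : ℝ) 2, r v * ∑ m ∈ S, (A m v) ^ (1 / 2 : ℝ) * (B m v) ^ (1 / 2 : ℝ) ≤
      (∫ v in Set.Icc (1 / 2 : ℝ) 2, r v ^ 2) ^ (1 / 2 : ℝ) *
        (∫ v in Set.Icc (1 / 2 : ℝ) 2, (∑ m ∈ S, A m v) ^ 2) ^ (1 / 4 : ℝ) *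
        (∫ v in Set.Icc (1 / 2 : ℝ) 2, (∑ m ∈ S, B m v) ^ 2) ^ (1 / 4 : ℝ) := by
  set I : Set ℝ := Set.Icc (1 / 2 : ℝ) 2 with hI
  set μ : Measure ℝ := (volume : Measure ℝ).restrict I with hμ
  set SA : ℝ → ℝ := fun v ↦ ∑ m ∈ S, A m v with hSA
  set SB : ℝ → ℝ := fun v ↦ ∑ m ∈ S, B m v with hSB
  have hSA0 : ∀ v, 0 ≤ SA v := fun v ↦ Finset.sum_nonneg fun m hm ↦ hA0 m hm v
  have hSB0 : ∀ v, 0 ≤ SB v := fun v ↦ Finset.sum_nonneg fun m hm ↦ hB0 m hm v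
  have hSAc : ContinuousOn SA I := continuousOn_finsetSum _ hA
  have hSBc : ContinuousOn SB I := continuousOn_finsetSum _ hB
  -- pointwise Cauchy–Schwarz in `m`
  have hpt : ∀ v, ∑ m ∈ S, (A m v) ^ (1 / 2 : ℝ) * (B m v) ^ (1 / 2 : ℝ) ≤ Real.sqrt (SA v) * Real.sqrt (SB v) := by
    intro v
    have h := Finset.sum_mul_sq_le_sq_mul_sq S (fun m ↦ (A m v) ^ (1 / 2 : ℝ)) (fun m ↦ (B m v) ^ (1 / 2 : ℝ))
    have eA : ∑ m ∈ S, ((A m v) ^ (1 / 2 : ℝ)) ^ 2 = SA v := by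
      refine Finset.sum_congr rfl fun m hm ↦ ?_
      rw [← Real.rpow_natCast, ← Real.rpow_mul (hA0 m hm v)]; norm_num
    have eB : ∑ m ∈ S, ((B m v) ^ (1 / 2 : ℝ)) ^ 2 = SB v := by
      refine Finset.sum_congr rfl fun m hm ↦ ?_
      rw [← Real.rpow_natCast, ← Real.rpow_mul (hB0 m hm v)]; norm_num
    rw [eA, eB] at h
    rw [← Real.sqrt_mul (hSA0 v)]
    exact (le_abs_self _).trans (Real.abs_le_sqrt h)
  -- first Hölder
  have hrm : MemLp r (ENNReal.ofReal 2) μ := memLp_two_of_continuousOn hr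
  have hg : ContinuousOn (fun v ↦ Real.sqrt (SA v) * Real.sqrt (SB v)) I :=
    (Real.continuous_sqrt.comp_continuousOn hSAc).mul (Real.continuous_sqrt.comp_continuousOn hSBc)
  have hgm : MemLp (fun v ↦ Real.sqrt (SA v) * Real.sqrt (SB v)) (ENNReal.ofReal 2) μ := memLp_two_of_continuousOn hg
  have h1 := integral_mul_le_Lp_mul_Lq_of_nonneg (μ := μ) Real.HolderConjugate.two_two
    (Eventually.of_forall hr0) (Eventually.of_forall fun v ↦ by positivity) hrm hgm
  -- second Hölder
  have hSAm : MemLp SA (ENNReal.ofReal 2) μ := memLp_two_of_continuousOn hSAc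
  have hSBm : MemLp SB (ENNReal.ofReal 2) μ := memLp_two_of_continuousOn hSBc
  have h2 := integral_mul_le_Lp_mul_Lq_of_nonneg (μ := μ) Real.HolderConjugate.two_two
    (Eventually.of_forall hSA0) (Eventually.of_forall hSB0) hSAm hSBm
  have epow : ∀ x : ℝ, x ^ (2 : ℝ) = x ^ 2 := fun x ↦ Real.rpow_two x
  have e3 : ∀ v, (Real.sqrt (SA v) * Real.sqrt (SB v)) ^ 2 = SA v * SB v := by
    intro v; rw [mul_pow, Real.sq_sqrt (hSA0 v), Real.sq_sqrt (hSB0 v)]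
  simp only [epow, one_div, e3] at h1 h2
  change ∫ v in I, r v * ∑ m ∈ S, (A m v) ^ (1 / 2 : ℝ) * (B m v) ^ (1 / 2 : ℝ) ≤
    (∫ v in I, r v ^ 2) ^ (1 / 2 : ℝ) * (∫ v in I, SA v ^ 2) ^ (1 / 4 : ℝ) * (∫ v in I, SB v ^ 2) ^ (1 / 4 : ℝ)
  -- combine
  have hI1 : 0 ≤ ∫ v in I, r v ^ 2 := setIntegral_nonneg measurableSet_Icc fun v _ ↦ sq_nonneg _
  have hI2 : 0 ≤ ∫ v in I, SA v ^ 2 := setIntegral_nonneg measurableSet_Icc fun v _ ↦ sq_nonneg _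
  have hI3 : 0 ≤ ∫ v in I, SB v ^ 2 := setIntegral_nonneg measurableSet_Icc fun v _ ↦ sq_nonneg _
  have hI4 : 0 ≤ ∫ v in I, SA v * SB v := setIntegral_nonneg measurableSet_Icc fun v _ ↦ mul_nonneg (hSA0 v) (hSB0 v)
  have hstep0 : ∫ v in I, r v * ∑ m ∈ S, (A m v) ^ (1 / 2 : ℝ) * (B m v) ^ (1 / 2 : ℝ) ≤
      ∫ v in I, r v * (Real.sqrt (SA v) * Real.sqrt (SB v)) := by
    refine setIntegral_mono_on ?_ ((hr.mul hg).integrableOn_Icc) measurableSet_Icc fun v _ ↦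
      mul_le_mul_of_nonneg_left (hpt v) (hr0 v)
    refine ContinuousOn.integrableOn_Icc (hr.mul (continuousOn_finsetSum _ fun m hm ↦ ?_))
    exact ((hA m hm).rpow_const fun v _ ↦ Or.inr (by norm_num)).mul
      ((hB m hm).rpow_const fun v _ ↦ Or.inr (by norm_num))
  calc ∫ v in I, r v * ∑ m ∈ S, (A m v) ^ (1 / 2 : ℝ) * (B m v) ^ (1 / 2 : ℝ)
      ≤ ∫ v in I, r v * (Real.sqrt (SA v) * Real.sqrt (SB v)) := hstep0
    _ ≤ (∫ v in I, r v ^ 2) ^ (2 : ℝ)⁻¹ * (∫ v in I, SA v * SB v) ^ (2 : ℝ)⁻¹ := h1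
    _ ≤ (∫ v in I, r v ^ 2) ^ (2 : ℝ)⁻¹ *
        ((∫ v in I, SA v ^ 2) ^ (2 : ℝ)⁻¹ * (∫ v in I, SB v ^ 2) ^ (2 : ℝ)⁻¹) ^ (2 : ℝ)⁻¹ :=
        mul_le_mul_of_nonneg_left (Real.rpow_le_rpow hI4 h2 (by norm_num)) (Real.rpow_nonneg hI1 _)
    _ = _ := by
        rw [Real.mul_rpow (by positivity) (by positivity), ← Real.rpow_mul hI2, ← Real.rpow_mul hI3]
        ring_nf

end CS

/-! ## §4. Comparison with `J(f_B)` -/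

section compare

variable (W : Finset ℝ) {B : ℝ} (hB : 0 < B)
include hB

/-- `affSum` of `f_B` is continuous with compact support (all `m₁ ∈ I₁`, `m₂ ∈ I₂` non-zero). [folklore] -/
theorem affSum_fB_integrable_sq (I₁ I₂ : Finset ℤ) (hI₁ : ∀ m ∈ I₁, m ≠ 0) (hI₂ : ∀ m ∈ I₂, m ≠ 0) (M₃ : ℕ) :
    Continuous (affSum (fB W B) I₁ I₂ M₃) ∧ Integrable (fun u ↦ affSum (fB W B) I₁ I₂ M₃ u ^ 2) := by
  have hc : Continuous (affSum (fB W B) I₁ I₂ M₃) := by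
    unfold affSum
    have := fB_continuous W hB
    fun_prop
  have hs : HasCompactSupport (affSum (fB W B) I₁ I₂ M₃) := by
    unfold affSum
    refine hasCompactSupport_fun_sum fun m₁ hm₁ ↦ hasCompactSupport_fun_sum fun m₂ hm₂ ↦
      hasCompactSupport_fun_sum fun k _ ↦ ?_
    have e : (fun u : ℝ ↦ fB W B (((m₁ : ℝ) * u + k) / m₂)) = fun u ↦ fB W B (((m₁ : ℝ) / m₂) * u + (k : ℝ) / m₂) := by
      ext u; congr 1; ring
    rw [e]
    exact hasCompactSupport_comp_affine (hasCompactSupport_fB W hB)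
      (div_ne_zero (by exact_mod_cast hI₁ m₁ hm₁) (by exact_mod_cast hI₂ m₂ hm₂)) _
  have e : (fun u ↦ affSum (fB W B) I₁ I₂ M₃ u ^ 2) =
      fun u ↦ affSum (fB W B) I₁ I₂ M₃ u * affSum (fB W B) I₁ I₂ M₃ u := by
    ext u; ring
  refine ⟨hc, ?_⟩
  rw [e]
  exact (hc.mul hc).integrable_of_hasCompactSupport hs.mul_right

/-- **`S₃,₄ ≤ J(f_B)`**: for a block `I₁ × I₂ × I₃` of shells (`I₂` symmetric, `I₃ ⊂ [−M₃top, M₃top]`),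
`∫_{[1/2,2]} (∑_m f_B(B_m v))² dv ≤ J(f_B; I₁, I₂, M₃top)` (reindex `m₂ ↦ −m₂`, enlarge the `m₃`-range,
extend the integral to `ℝ`). [cite: GuthMaynard2026, proof of Proposition 10.1 (`S₃,₄`)] -/
theorem setIntegral_sq_sum_affB_le {M₀ i₂ : ℕ} (I₁ I₃ : Finset ℤ) (hI₁ : ∀ m ∈ I₁, m ≠ 0)
    {M₃top : ℕ} (hI₃ : I₃ ⊆ Finset.Icc (-(M₃top : ℤ)) M₃top) :
    ∫ v in Set.Icc (1 / 2 : ℝ) 2, (∑ m ∈ I₁ ×ˢ (shell M₀ i₂ ×ˢ I₃), fB W B (affB m v)) ^ 2 ≤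
      Jfun (fB W B) I₁ (shell M₀ i₂) M₃top := by
  set I₂ := shell M₀ i₂ with hI₂
  have hI₂0 : ∀ m ∈ I₂, m ≠ 0 := fun _ hm ↦ ne_zero_of_mem_shell hm
  have hf0 : ∀ x, 0 ≤ fB W B x := fB_nonneg W hB.le
  -- pointwise comparison
  have hpt : ∀ v, ∑ m ∈ I₁ ×ˢ (I₂ ×ˢ I₃), fB W B (affB m v) ≤ affSum (fB W B) I₁ I₂ M₃top v := by
    intro v
    rw [Finset.sum_product]
    unfold affSum
    refine Finset.sum_le_sum fun m₁ _ ↦ ?_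
    rw [Finset.sum_product]
    -- reindex `m₂ ↦ −m₂`
    have e : ∑ m₂ ∈ I₂, ∑ m₃ ∈ I₃, fB W B (affB (m₁, m₂, m₃) v) =
        ∑ m₂ ∈ I₂, ∑ m₃ ∈ I₃, fB W B (((m₁ : ℝ) * v + m₃) / m₂) := by
      rw [← sum_shell_neg]
      refine Finset.sum_congr rfl fun m₂ _ ↦ Finset.sum_congr rfl fun m₃ _ ↦ ?_
      simp only [affB]
      congr 1
      push_cast
      rw [neg_div, div_neg, neg_neg]  -- `-(x)/(-m₂) = x/m₂`
    rw [e]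
    refine Finset.sum_le_sum fun m₂ _ ↦ ?_
    exact Finset.sum_le_sum_of_subset_of_nonneg hI₃ fun m₃ _ _ ↦ hf0 _
  have hpt0 : ∀ v, 0 ≤ ∑ m ∈ I₁ ×ˢ (I₂ ×ˢ I₃), fB W B (affB m v) := fun v ↦ Finset.sum_nonneg fun m _ ↦ hf0 _
  obtain ⟨-, hi⟩ := affSum_fB_integrable_sq W hB I₁ I₂ hI₁ hI₂0 M₃top
  calc ∫ v in Set.Icc (1 / 2 : ℝ) 2, (∑ m ∈ I₁ ×ˢ (I₂ ×ˢ I₃), fB W B (affB m v)) ^ 2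
      ≤ ∫ v in Set.Icc (1 / 2 : ℝ) 2, affSum (fB W B) I₁ I₂ M₃top v ^ 2 := by
        refine setIntegral_mono_on ?_ hi.integrableOn measurableSet_Icc fun v _ ↦
          pow_le_pow_left₀ (hpt0 v) (hpt v) 2
        refine ContinuousOn.integrableOn_Icc (Continuous.continuousOn ?_)
        have := fB_continuous W hB
        have hcB : ∀ m : ℤ × ℤ × ℤ, Continuous (affB m) := fun m ↦ by unfold affB; fun_prop
        fun_prop
    _ ≤ ∫ v, affSum (fB W B) I₁ I₂ M₃top v ^ 2 :=
        setIntegral_le_integral hi (Eventually.of_forall fun v ↦ sq_nonneg _)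
    _ = Jfun (fB W B) I₁ I₂ M₃top := rfl

omit hB in
/-- **The substitution `u = 1/v` on `[1/2, 2]`**: `∫_{[1/2,2]} g(1/v) dv = ∫_{[1/2,2]} x^{-2} g(x) dx`.
[cite: GuthMaynard2026, proof of Proposition 10.1 ("we make a change of variables `u = 1/v`")] -/
theorem setIntegral_comp_one_div (g : ℝ → ℝ) :
    ∫ v in Set.Icc (1 / 2 : ℝ) 2, g (1 / v) = ∫ x in Set.Icc (1 / 2 : ℝ) 2, (x ^ 2)⁻¹ * g x := by
  have himage : (fun x : ℝ ↦ x⁻¹) '' Set.Icc (1 / 2 : ℝ) 2 = Set.Icc (1 / 2 : ℝ) 2 := by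
    ext y
    constructor
    · rintro ⟨x, hx, rfl⟩
      have hx0 : 0 < x := by linarith [hx.1]
      constructor
      · rw [le_inv_comm₀ (by norm_num) hx0]; norm_num; exact hx.2
      · rw [inv_le_comm₀ hx0 (by norm_num)]; linarith [hx.1]
    · intro hy
      have hy0 : 0 < y := by linarith [hy.1]
      refine ⟨y⁻¹, ⟨?_, ?_⟩, inv_inv y⟩
      · rw [le_inv_comm₀ (by norm_num) hy0]; norm_num; exact hy.2
      · rw [inv_le_comm₀ hy0 (by norm_num)]; linarith [hy.1]
  have hderiv : ∀ x ∈ Set.Icc (1 / 2 : ℝ) 2, HasDerivWithinAt (fun x : ℝ ↦ x⁻¹) (-(x ^ 2)⁻¹) (Set.Icc (1 / 2 : ℝ) 2) x :=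
    fun x hx ↦ (hasDerivAt_inv (by linarith [hx.1] : (0:ℝ) < x).ne').hasDerivWithinAt
  have hinj : Set.InjOn (fun x : ℝ ↦ x⁻¹) (Set.Icc (1 / 2 : ℝ) 2) := fun x _ y _ h ↦ inv_injective h
  have h := integral_image_eq_integral_abs_deriv_smul measurableSet_Icc hderiv hinj (fun y ↦ g (1 / y))
  rw [himage] at h
  rw [h]
  refine setIntegral_congr_fun measurableSet_Icc fun x _ ↦ ?_
  simp only [smul_eq_mul, one_div, inv_inv, abs_neg, abs_inv, abs_pow, sq_abs]

/-- **`S₃,₃ ≤ 4J(f_B)` after `u = 1/v`**: for a block `I₁ × I₂ × I₃` of shells (`I₂` symmetric,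
`I₁ ⊂ [−M₁top, M₁top]`), `∫_{[1/2,2]} (∑_m f_B(A_m v))² dv ≤ 4 J(f_B; I₃, I₂, M₁top)`.
[cite: GuthMaynard2026, proof of Proposition 10.1 (`S₃,₃`)] -/
theorem setIntegral_sq_sum_affA_le {M₀ i₂ : ℕ} (I₁ I₃ : Finset ℤ) (hI₃ : ∀ m ∈ I₃, m ≠ 0)
    {M₁top : ℕ} (hI₁ : I₁ ⊆ Finset.Icc (-(M₁top : ℤ)) M₁top) :
    ∫ v in Set.Icc (1 / 2 : ℝ) 2, (∑ m ∈ I₁ ×ˢ (shell M₀ i₂ ×ˢ I₃), fB W B (affA m v)) ^ 2 ≤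
      4 * Jfun (fB W B) I₃ (shell M₀ i₂) M₁top := by
  set I₂ := shell M₀ i₂ with hI₂
  have hI₂0 : ∀ m ∈ I₂, m ≠ 0 := fun _ hm ↦ ne_zero_of_mem_shell hm
  have hf0 : ∀ x, 0 ≤ fB W B x := fB_nonneg W hB.le
  -- the function of `u = 1/v`
  set H : ℝ → ℝ := fun u ↦ ∑ m ∈ I₁ ×ˢ (I₂ ×ˢ I₃), fB W B (-((m.2.2 : ℝ) * u + m.1) / m.2.1) with hH
  have hHv : ∀ v ∈ Set.Icc (1 / 2 : ℝ) 2, ∑ m ∈ I₁ ×ˢ (I₂ ×ˢ I₃), fB W B (affA m v) = H (1 / v) := by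
    intro v hv
    have hv0 : v ≠ 0 := by intro h; rw [h] at hv; linarith [hv.1]
    simp only [hH]
    refine Finset.sum_congr rfl fun m hm ↦ ?_
    simp only [Finset.mem_product] at hm
    have hm2 : (m.2.1 : ℝ) ≠ 0 := by exact_mod_cast ne_zero_of_mem_shell hm.2.1
    simp only [affA, affB]
    congr 1
    field_simp; ring
  have hH0 : ∀ u, 0 ≤ H u := fun u ↦ Finset.sum_nonneg fun m _ ↦ hf0 _
  have hHc : Continuous H := by
    simp only [hH]
    have := fB_continuous W hB
    fun_prop
  -- `H ≤ affSum f_B I₃ I₂ M₁top`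
  have hHle : ∀ u, H u ≤ affSum (fB W B) I₃ I₂ M₁top u := by
    intro u
    -- `H u = ∑_{m₁} ∑_{m₂} ∑_{m₃} f_B((m₃u + m₁)/m₂)` (reindex `m₂ ↦ −m₂`)
    have step1 : H u = ∑ m₁ ∈ I₁, ∑ m₂ ∈ I₂, ∑ m₃ ∈ I₃, fB W B (((m₃ : ℝ) * u + m₁) / m₂) := by
      simp only [hH]
      rw [Finset.sum_product]
      refine Finset.sum_congr rfl fun m₁ _ ↦ ?_
      rw [Finset.sum_product, ← sum_shell_neg]
      refine Finset.sum_congr rfl fun m₂ _ ↦ Finset.sum_congr rfl fun m₃ _ ↦ ?_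
      try dsimp only
      congr 1
      push_cast
      rw [neg_div, div_neg, neg_neg]
    -- reorder both sides to `∑_{m₂} ∑_{m₃} ∑_{·}`
    have eL : ∑ m₁ ∈ I₁, ∑ m₂ ∈ I₂, ∑ m₃ ∈ I₃, fB W B (((m₃ : ℝ) * u + m₁) / m₂) =
        ∑ m₂ ∈ I₂, ∑ m₃ ∈ I₃, ∑ m₁ ∈ I₁, fB W B (((m₃ : ℝ) * u + m₁) / m₂) := by
      rw [Finset.sum_comm]
      exact Finset.sum_congr rfl fun m₂ _ ↦ Finset.sum_comm
    have eR : affSum (fB W B) I₃ I₂ M₁top u =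
        ∑ m₂ ∈ I₂, ∑ m₃ ∈ I₃, ∑ k ∈ Finset.Icc (-(M₁top : ℤ)) M₁top, fB W B (((m₃ : ℝ) * u + k) / m₂) := by
      unfold affSum
      rw [Finset.sum_comm]
    rw [step1, eL, eR]
    exact Finset.sum_le_sum fun m₂ _ ↦ Finset.sum_le_sum fun m₃ _ ↦
      Finset.sum_le_sum_of_subset_of_nonneg hI₁ fun m₁ _ _ ↦ hf0 _
  obtain ⟨-, hi⟩ := affSum_fB_integrable_sq W hB I₃ I₂ hI₃ hI₂0 M₁top
  calc ∫ v in Set.Icc (1 / 2 : ℝ) 2, (∑ m ∈ I₁ ×ˢ (I₂ ×ˢ I₃), fB W B (affA m v)) ^ 2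
      = ∫ v in Set.Icc (1 / 2 : ℝ) 2, (fun y ↦ H y ^ 2) (1 / v) :=
        setIntegral_congr_fun measurableSet_Icc fun v hv ↦ by simp only [hHv v hv]
    _ = ∫ x in Set.Icc (1 / 2 : ℝ) 2, (x ^ 2)⁻¹ * H x ^ 2 := setIntegral_comp_one_div (fun y ↦ H y ^ 2)
    _ ≤ ∫ x in Set.Icc (1 / 2 : ℝ) 2, 4 * affSum (fB W B) I₃ I₂ M₁top x ^ 2 := by
        have hcont : ContinuousOn (fun x : ℝ ↦ (x ^ 2)⁻¹ * H x ^ 2) (Set.Icc (1 / 2 : ℝ) 2) := by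
          refine ContinuousOn.mul ?_ (hHc.pow 2).continuousOn
          refine (continuousOn_pow 2).inv₀ fun x hx ↦ ?_
          have : (0:ℝ) < x := by linarith [hx.1]
          positivity
        refine setIntegral_mono_on hcont.integrableOn_Icc ((hi.const_mul 4).integrableOn) measurableSet_Icc
          fun x hx ↦ ?_
        · have hx0 : 0 < x := by linarith [hx.1]
          have h4 : (x ^ 2)⁻¹ ≤ 4 := by
            rw [inv_le_comm₀ (by positivity) (by norm_num)]
            nlinarith [hx.1]
          exact mul_le_mul h4 (pow_le_pow_left₀ (hH0 x) (hHle x) 2) (sq_nonneg _) (by norm_num)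
    _ = 4 * ∫ x in Set.Icc (1 / 2 : ℝ) 2, affSum (fB W B) I₃ I₂ M₁top x ^ 2 := integral_const_mul _ _
    _ ≤ 4 * Jfun (fB W B) I₃ I₂ M₁top := by
        refine mul_le_mul_of_nonneg_left ?_ (by norm_num)
        exact setIntegral_le_integral hi (Eventually.of_forall fun v ↦ sq_nonneg _)

end compare

/-! ## §5. One block -/

section block

variable {w : ℝ → ℝ} (hw : ContDiff ℝ ∞ w) (hsupp : Function.support w ⊆ Set.Icc 1 2)
include hw hsupp

omit hw hsupp in
/-- `∫_{[1/2,2]} |R|² ≤ ∫ g_W`. [cite: GuthMaynard2026, Lemma 8.2] -/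
theorem setIntegral_normSq_R_le_gW (W : Finset ℝ) :
    ∫ v in Set.Icc (1 / 2 : ℝ) 2, ‖Rfun W v‖ ^ 2 ≤ ∫ u, gW W u := by
  rw [← integral_indicator measurableSet_Icc]
  refine integral_mono_of_nonneg (Eventually.of_forall fun v ↦ Set.indicator_nonneg (fun _ _ ↦ sq_nonneg _) _)
    (gW_integrable W) (Eventually.of_forall fun v ↦ ?_)
  exact (Set.indicator_le_indicator_of_subset (Set.Icc_subset_Icc (by norm_num) (by norm_num))
    (fun _ ↦ sq_nonneg _) v).trans (indicator_normSq_le_gW W v)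

omit hw hsupp in
/-- **The analytic block estimate**: for a block `S = I₁ × shell × I₃` and `B > 0`,
`∑_{m∈S} ∫_{[1/2,2]} |R(v)| f_B(A_m v)^{1/2} f_B(B_m v)^{1/2} dv
  ≤ (∫ g_W)^{1/2} (4J(f_B; I₃, I₂, M₁top))^{1/4} (J(f_B; I₁, I₂, M₃top))^{1/4}`.
[cite: GuthMaynard2026, proof of Proposition 10.1 (`S₃,₀`–`S₃,₄`)] -/
theorem block_main_le (W : Finset ℝ) {B : ℝ} (hB : 0 < B) {M₀ i₂ : ℕ} (I₁ I₃ : Finset ℤ)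
    (hI₁ : ∀ m ∈ I₁, m ≠ 0) (hI₃ : ∀ m ∈ I₃, m ≠ 0)
    {M₁top M₃top : ℕ} (hI₁t : I₁ ⊆ Finset.Icc (-(M₁top : ℤ)) M₁top) (hI₃t : I₃ ⊆ Finset.Icc (-(M₃top : ℤ)) M₃top) :
    ∑ m ∈ I₁ ×ˢ (shell M₀ i₂ ×ˢ I₃), ∫ v in Set.Icc (1 / 2 : ℝ) 2, ‖Rfun W v‖ *
        ((fB W B (affA m v)) ^ (1 / 2 : ℝ) * (fB W B (affB m v)) ^ (1 / 2 : ℝ)) ≤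
      (∫ u, gW W u) ^ (1 / 2 : ℝ) * (4 * Jfun (fB W B) I₃ (shell M₀ i₂) M₁top) ^ (1 / 4 : ℝ) *
        (Jfun (fB W B) I₁ (shell M₀ i₂) M₃top) ^ (1 / 4 : ℝ) := by
  set S := I₁ ×ˢ (shell M₀ i₂ ×ˢ I₃) with hS
  set I : Set ℝ := Set.Icc (1 / 2 : ℝ) 2 with hI
  have hf0 : ∀ x, 0 ≤ fB W B x := fB_nonneg W hB.le
  have hfBc := fB_continuous W hB
  have hcB : ∀ m : ℤ × ℤ × ℤ, Continuous (affB m) := fun m ↦ by unfold affB; fun_prop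
  have hcA : ∀ m : ℤ × ℤ × ℤ, ContinuousOn (affA m) I := fun m ↦ by
    unfold affA
    exact (hcB m).continuousOn.div continuousOn_id fun v hv ↦ (by linarith [hv.1] : (0:ℝ) < v).ne'
  have hr : ContinuousOn (fun v ↦ ‖Rfun W v‖) I := fun v hv ↦
    (continuousAt_Rfun W (by linarith [hv.1] : (0:ℝ) < v).ne').norm.continuousWithinAt
  -- swap sum and integral
  have hterm_i : ∀ m ∈ S, IntegrableOn (fun v ↦ ‖Rfun W v‖ *
      ((fB W B (affA m v)) ^ (1 / 2 : ℝ) * (fB W B (affB m v)) ^ (1 / 2 : ℝ))) I := by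
    intro m _
    refine ContinuousOn.integrableOn_Icc (hr.mul ?_)
    exact ((hfBc.comp_continuousOn (hcA m)).rpow_const fun v _ ↦ Or.inr (by norm_num)).mul
      (((hfBc.comp (hcB m)).rpow_const fun v ↦ Or.inr (by norm_num)).continuousOn)
  rw [← integral_finsetSum _ hterm_i]
  have e : ∀ v, ∑ m ∈ S, ‖Rfun W v‖ * ((fB W B (affA m v)) ^ (1 / 2 : ℝ) * (fB W B (affB m v)) ^ (1 / 2 : ℝ)) =
      ‖Rfun W v‖ * ∑ m ∈ S, (fB W B (affA m v)) ^ (1 / 2 : ℝ) * (fB W B (affB m v)) ^ (1 / 2 : ℝ) := by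
    intro v; rw [Finset.mul_sum]
  simp_rw [e]
  have hCS := setIntegral_sum_sqrt_mul_le S hr (fun v ↦ norm_nonneg _)
    (A := fun m v ↦ fB W B (affA m v)) (B := fun m v ↦ fB W B (affB m v))
    (fun m _ ↦ hfBc.comp_continuousOn (hcA m)) (fun m _ v ↦ hf0 _)
    (fun m _ ↦ (hfBc.comp (hcB m)).continuousOn) (fun m _ v ↦ hf0 _)
  refine hCS.trans ?_
  have h1 : (∫ v in I, ‖Rfun W v‖ ^ 2) ^ (1 / 2 : ℝ) ≤ (∫ u, gW W u) ^ (1 / 2 : ℝ) :=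
    Real.rpow_le_rpow (setIntegral_nonneg measurableSet_Icc fun v _ ↦ sq_nonneg _)
      (setIntegral_normSq_R_le_gW W) (by norm_num)
  have h2 : (∫ v in I, (∑ m ∈ S, fB W B (affA m v)) ^ 2) ^ (1 / 4 : ℝ) ≤
      (4 * Jfun (fB W B) I₃ (shell M₀ i₂) M₁top) ^ (1 / 4 : ℝ) :=
    Real.rpow_le_rpow (setIntegral_nonneg measurableSet_Icc fun v _ ↦ sq_nonneg _)
      (setIntegral_sq_sum_affA_le W hB I₁ I₃ hI₃ hI₁t) (by norm_num)
  have h3 : (∫ v in I, (∑ m ∈ S, fB W B (affB m v)) ^ 2) ^ (1 / 4 : ℝ) ≤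
      (Jfun (fB W B) I₁ (shell M₀ i₂) M₃top) ^ (1 / 4 : ℝ) :=
    Real.rpow_le_rpow (setIntegral_nonneg measurableSet_Icc fun v _ ↦ sq_nonneg _)
      (setIntegral_sq_sum_affB_le W hB I₁ I₃ hI₁ hI₃t) (by norm_num)
  have n1 : 0 ≤ (∫ v in I, (∑ m ∈ S, fB W B (affA m v)) ^ 2) ^ (1 / 4 : ℝ) :=
    Real.rpow_nonneg (setIntegral_nonneg measurableSet_Icc fun v _ ↦ sq_nonneg _) _
  have n2 : 0 ≤ (∫ u, gW W u) ^ (1 / 2 : ℝ) := Real.rpow_nonneg (integral_nonneg (gW_nonneg W)) _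
  have n3 : 0 ≤ (∫ v in I, (∑ m ∈ S, fB W B (affB m v)) ^ 2) ^ (1 / 4 : ℝ) :=
    Real.rpow_nonneg (setIntegral_nonneg measurableSet_Icc fun v _ ↦ sq_nonneg _) _
  have n4 : 0 ≤ (4 * Jfun (fB W B) I₃ (shell M₀ i₂) M₁top) ^ (1 / 4 : ℝ) :=
    Real.rpow_nonneg (mul_nonneg (by norm_num) (integral_nonneg fun u ↦ sq_nonneg _)) _
  exact mul_le_mul (mul_le_mul h1 h2 n1 n2) h3 n3 (mul_nonneg n2 n4)

/-- **One block, localised in `v₂`** (`|m₂| ≥ 2^{i₂} = M₂`): with `B = N2^{i₂}N^{-η}`,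
`∑_{m ∈ shell i₁ × shell i₂ × shell i₃} |I_m| ≤ C (N³/B) (∫g_W)^{1/2} (4J₃₃)^{1/4} J₃₄^{1/4}
  + C |block| N³|W|³N^{-ηj}`. [cite: GuthMaynard2026, Proposition 7.2 and proof of Proposition 10.1] -/
theorem block_sum_le_snd {η : ℝ} (hη : 0 < η) (j : ℕ) : ∃ C, 0 ≤ C ∧ ∀ (N : ℕ), 1 ≤ N →
    ∀ (W : Finset ℝ) (M₀ i₁ i₂ i₃ : ℕ),
      ∑ m ∈ shell M₀ i₁ ×ˢ (shell M₀ i₂ ×ˢ shell M₀ i₃), ‖Im w N W m‖ ≤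
        C * ((N : ℝ) ^ 3 / ((N : ℝ) * 2 ^ i₂ / (N : ℝ) ^ η)) *
          ((∫ u, gW W u) ^ (1 / 2 : ℝ) *
            (4 * Jfun (fB W ((N : ℝ) * 2 ^ i₂ / (N : ℝ) ^ η)) (shell M₀ i₃) (shell M₀ i₂) (2 ^ (i₁ + 1))) ^ (1 / 4 : ℝ) *
            (Jfun (fB W ((N : ℝ) * 2 ^ i₂ / (N : ℝ) ^ η)) (shell M₀ i₁) (shell M₀ i₂) (2 ^ (i₃ + 1))) ^ (1 / 4 : ℝ)) +
        C * ((shell M₀ i₁ ×ˢ (shell M₀ i₂ ×ˢ shell M₀ i₃)).card : ℝ) *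
          ((N : ℝ) ^ 3 * (W.card : ℝ) ^ 3 * (N : ℝ) ^ (-(η * j))) := by
  obtain ⟨C, hC0, hC⟩ := norm_Im_le_localised hw hsupp hη j
  refine ⟨C, hC0, fun N hN W M₀ i₁ i₂ i₃ ↦ ?_⟩
  set S := shell M₀ i₁ ×ˢ (shell M₀ i₂ ×ˢ shell M₀ i₃) with hS
  set M₂ : ℝ := 2 ^ i₂ with hM₂
  have hM₂1 : 1 ≤ M₂ := one_le_pow₀ (by norm_num)
  set B : ℝ := (N : ℝ) * M₂ / (N : ℝ) ^ η with hB
  have hN0 : (0 : ℝ) < N := by exact_mod_cast hN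
  have hB0 : 0 < B := by positivity
  -- termwise
  have hterm : ∀ m ∈ S, ‖Im w N W m‖ ≤ C * ((N : ℝ) ^ 3 / B) *
      (∫ v in Set.Icc (1 / 2 : ℝ) 2, ‖Rfun W v‖ * ((fB W B (affA m v)) ^ (1 / 2 : ℝ) * (fB W B (affB m v)) ^ (1 / 2 : ℝ))) +
      C * (N : ℝ) ^ 3 * (W.card : ℝ) ^ 3 * (N : ℝ) ^ (-(η * j)) := by
    intro m hm
    simp only [hS, Finset.mem_product] at hm
    exact hC N hN W M₂ hM₂1 m (shell_bounds hm.2.1).1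
  refine (Finset.sum_le_sum hterm).trans ?_
  rw [Finset.sum_add_distrib, Finset.sum_const, nsmul_eq_mul, ← Finset.mul_sum]
  have hmain := block_main_le W hB0 (M₀ := M₀) (i₂ := i₂) (shell M₀ i₁) (shell M₀ i₃)
    (fun _ hm ↦ ne_zero_of_mem_shell hm) (fun _ hm ↦ ne_zero_of_mem_shell hm)
    (shell_subset_Icc M₀ i₁) (shell_subset_Icc M₀ i₃)
  have h1 : C * ((N : ℝ) ^ 3 / B) * ∑ m ∈ S, ∫ v in Set.Icc (1 / 2 : ℝ) 2, ‖Rfun W v‖ *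
      ((fB W B (affA m v)) ^ (1 / 2 : ℝ) * (fB W B (affB m v)) ^ (1 / 2 : ℝ)) ≤
      C * ((N : ℝ) ^ 3 / B) * ((∫ u, gW W u) ^ (1 / 2 : ℝ) *
        (4 * Jfun (fB W B) (shell M₀ i₃) (shell M₀ i₂) (2 ^ (i₁ + 1))) ^ (1 / 4 : ℝ) *
        (Jfun (fB W B) (shell M₀ i₁) (shell M₀ i₂) (2 ^ (i₃ + 1))) ^ (1 / 4 : ℝ)) := by
    refine mul_le_mul_of_nonneg_left ?_ (by positivity)
    exact_mod_cast hmain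
  linarith [h1]

/-- **One block, localised in `v₁`** (`|m₁| ≥ 2^{i₁} = M₁`): with `B = N2^{i₁}N^{-η}` and the roles of the
first two shells exchanged,
`∑_{m ∈ shell i₁ × shell i₂ × shell i₃} |I_m| ≤ C (N³/B) (∫g_W)^{1/2} (4J(f_B; shell i₃, shell i₁, 2^{i₂+1}))^{1/4}
  J(f_B; shell i₂, shell i₁, 2^{i₃+1})^{1/4} + C |block| N³|W|³N^{-ηj}`.
[cite: GuthMaynard2026, Proposition 7.2 and proof of Proposition 10.1] -/
theorem block_sum_le_fst {η : ℝ} (hη : 0 < η) (j : ℕ) : ∃ C, 0 ≤ C ∧ ∀ (N : ℕ), 1 ≤ N →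
    ∀ (W : Finset ℝ) (M₀ i₁ i₂ i₃ : ℕ),
      ∑ m ∈ shell M₀ i₁ ×ˢ (shell M₀ i₂ ×ˢ shell M₀ i₃), ‖Im w N W m‖ ≤
        C * ((N : ℝ) ^ 3 / ((N : ℝ) * 2 ^ i₁ / (N : ℝ) ^ η)) *
          ((∫ u, gW W u) ^ (1 / 2 : ℝ) *
            (4 * Jfun (fB W ((N : ℝ) * 2 ^ i₁ / (N : ℝ) ^ η)) (shell M₀ i₃) (shell M₀ i₁) (2 ^ (i₂ + 1))) ^ (1 / 4 : ℝ) *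
            (Jfun (fB W ((N : ℝ) * 2 ^ i₁ / (N : ℝ) ^ η)) (shell M₀ i₂) (shell M₀ i₁) (2 ^ (i₃ + 1))) ^ (1 / 4 : ℝ)) +
        C * ((shell M₀ i₁ ×ˢ (shell M₀ i₂ ×ˢ shell M₀ i₃)).card : ℝ) *
          ((N : ℝ) ^ 3 * (W.card : ℝ) ^ 3 * (N : ℝ) ^ (-(η * j))) := by
  obtain ⟨C, hC0, hC⟩ := norm_Im_le_localised_fst hw hsupp hη j
  refine ⟨C, hC0, fun N hN W M₀ i₁ i₂ i₃ ↦ ?_⟩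
  set S := shell M₀ i₁ ×ˢ (shell M₀ i₂ ×ˢ shell M₀ i₃) with hS
  set S' := shell M₀ i₂ ×ˢ (shell M₀ i₁ ×ˢ shell M₀ i₃) with hS'
  set M₁ : ℝ := 2 ^ i₁ with hM₁
  have hM₁1 : 1 ≤ M₁ := one_le_pow₀ (by norm_num)
  set B : ℝ := (N : ℝ) * M₁ / (N : ℝ) ^ η with hB
  have hN0 : (0 : ℝ) < N := by exact_mod_cast hN
  have hB0 : 0 < B := by positivity
  set main : ℤ × ℤ × ℤ → ℝ := fun m ↦ ∫ v in Set.Icc (1 / 2 : ℝ) 2, ‖Rfun W v‖ *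
    ((fB W B (affA m v)) ^ (1 / 2 : ℝ) * (fB W B (affB m v)) ^ (1 / 2 : ℝ)) with hmain_def
  -- termwise, with the swapped triple
  have hterm : ∀ m ∈ S, ‖Im w N W m‖ ≤ C * ((N : ℝ) ^ 3 / B) * main (m.2.1, m.1, m.2.2) +
      C * (N : ℝ) ^ 3 * (W.card : ℝ) ^ 3 * (N : ℝ) ^ (-(η * j)) := by
    intro m hm
    simp only [hS, Finset.mem_product] at hm
    exact hC N hN W M₁ hM₁1 m (shell_bounds hm.1).1
  refine (Finset.sum_le_sum hterm).trans ?_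
  rw [Finset.sum_add_distrib, Finset.sum_const, nsmul_eq_mul, ← Finset.mul_sum]
  -- reindex by the swap
  have hswap : ∑ m ∈ S, main (m.2.1, m.1, m.2.2) = ∑ m ∈ S', main m := by
    refine Finset.sum_nbij' (fun m ↦ (m.2.1, m.1, m.2.2)) (fun m ↦ (m.2.1, m.1, m.2.2)) ?_ ?_
      (fun m _ ↦ rfl) (fun m _ ↦ rfl) (fun m _ ↦ rfl)
    · intro m hm
      simp only [hS, hS', Finset.mem_product] at hm ⊢
      exact ⟨hm.2.1, hm.1, hm.2.2⟩
    · intro m hm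
      simp only [hS, hS', Finset.mem_product] at hm ⊢
      exact ⟨hm.2.1, hm.1, hm.2.2⟩
  rw [hswap]
  have hmain := block_main_le W hB0 (M₀ := M₀) (i₂ := i₁) (shell M₀ i₂) (shell M₀ i₃)
    (fun _ hm ↦ ne_zero_of_mem_shell hm) (fun _ hm ↦ ne_zero_of_mem_shell hm)
    (shell_subset_Icc M₀ i₂) (shell_subset_Icc M₀ i₃)
  have h1 : C * ((N : ℝ) ^ 3 / B) * ∑ m ∈ S', main m ≤
      C * ((N : ℝ) ^ 3 / B) * ((∫ u, gW W u) ^ (1 / 2 : ℝ) *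
        (4 * Jfun (fB W B) (shell M₀ i₃) (shell M₀ i₁) (2 ^ (i₂ + 1))) ^ (1 / 4 : ℝ) *
        (Jfun (fB W B) (shell M₀ i₂) (shell M₀ i₁) (2 ^ (i₃ + 1))) ^ (1 / 4 : ℝ)) := by
    refine mul_le_mul_of_nonneg_left ?_ (by positivity)
    exact_mod_cast hmain
  linarith [h1]

end block

end GuthMaynardS3Blocks


namespace GuthMaynardS3Final

open GuthMaynardFourier GuthMaynardRFunction GuthMaynardS3 GuthMaynardSmoothR GuthMaynardS3Loc
  GuthMaynardAffine GuthMaynardS3Blocks GuthMaynardAssembly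

/-! ## §1. `f_B` is admissible for Proposition 9.1 -/

/-- `∫ ψ₁ ≤ 6` (`0 ≤ ψ₁ ≤ 1`, supported in `[−3, 3]`). [folklore] -/
theorem integral_psi1_le_six : ∫ x, psi1 x ≤ 6 := by
  have h1 : ∀ x, psi1 x ≤ (Set.Icc (-3 : ℝ) 3).indicator (fun _ ↦ (1 : ℝ)) x := by
    intro x
    by_cases hx : x ∈ Set.Icc (-3 : ℝ) 3
    · rw [Set.indicator_of_mem hx]; exact psi1_le_one x
    · rw [Set.indicator_of_notMem hx]
      by_contra h
      have hne : psi1 x ≠ 0 := by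
        intro h0; rw [h0] at h; exact h le_rfl
      have := abs_lt_of_psi1_ne_zero hne
      apply hx
      rw [Set.mem_Icc, ← abs_le]; exact this.le
  calc ∫ x, psi1 x ≤ ∫ x, (Set.Icc (-3 : ℝ) 3).indicator (fun _ ↦ (1 : ℝ)) x :=
        integral_mono psi1_integrable ((integrable_indicator_iff measurableSet_Icc).mpr
          (integrableOn_const (by rw [Real.volume_Icc]; exact ENNReal.ofReal_ne_top))) h1
    _ = 6 := by
        rw [integral_indicator measurableSet_Icc, setIntegral_const, Real.volume_real_Icc_of_le (by norm_num),
          smul_eq_mul]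
        norm_num

/-- **Support of `f_B`** for `B ≥ 48`: `f_B(x) ≠ 0 ⇒ 1/16 ≤ x ≤ 9/2`. [cite: GuthMaynard2026, (7.5)] -/
theorem fB_support (W : Finset ℝ) {B : ℝ} (_hB : 48 ≤ B) {x : ℝ} (hx : fB W B x ≠ 0) :
    1 / 16 ≤ x ∧ x ≤ 9 / 2 := by
  have hB0 : 0 < B := by linarith
  by_contra hcon
  apply hx
  apply fB_eq_zero_of_notMem W hB0
  intro h
  apply hcon
  have h3 : 3 / B ≤ 1 / 16 := by rw [div_le_iff₀ hB0]; linarith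
  constructor <;> linarith [h.1, h.2]

/-- **`f_B` has the Fourier decay of the class of Proposition 9.1** at any height `T_a` with `B ≤ T_a` and
`C_F ≤ ‖ψ₁‖₁ T_a²`, where `C_F` is the constant of Lemma 8.4 for `j = 4`:
`|𝓕f_B(ζ)| ≤ T_a² ‖f_B‖₁ (T_a/|ζ|)⁴`. [cite: GuthMaynard2026, Lemma 8.4 and Proposition 10.1] -/
theorem fB_decay_class {C_F : ℝ}
    (hCF : ∀ (W : Finset ℝ) (B : ℝ), 0 < B → ∀ ξ : ℝ, ξ ≠ 0 →
      ‖𝓕 (fun x ↦ ((fB W B x : ℝ) : ℂ)) ξ‖ ≤ C_F * (B / |ξ|) ^ 4 * ∫ u, gW W u)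
    (W : Finset ℝ) {B T_a : ℝ} (hB : 0 < B) (_hBT : B ≤ T_a) (_hCT : C_F ≤ (∫ x, psi1 x) * T_a ^ 2)
    {ζ : ℝ} (hζ : ζ ≠ 0) :
    ‖𝓕 (fun x ↦ ((fB W B x : ℝ) : ℂ)) ζ‖ ≤ T_a ^ 2 * (∫ x, fB W B x) * (T_a / |ζ|) ^ 4 := by
  have hg0 : 0 ≤ ∫ u, gW W u := integral_nonneg (gW_nonneg W)
  have hζ0 : 0 < |ζ| := abs_pos.mpr hζ
  refine (hCF W B hB ζ hζ).trans ?_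
  rw [integral_fB W hB]
  have hP0 : 0 < ∫ x, psi1 x := integral_psi1_pos
  calc C_F * (B / |ζ|) ^ 4 * ∫ u, gW W u ≤ ((∫ x, psi1 x) * T_a ^ 2) * (T_a / |ζ|) ^ 4 * ∫ u, gW W u := by
        have hC : 0 ≤ C_F ∨ C_F < 0 := le_or_gt 0 C_F
        rcases hC with hC | hC
        · gcongr
        · have : C_F * (B / |ζ|) ^ 4 * ∫ u, gW W u ≤ 0 :=
            mul_nonpos_of_nonpos_of_nonneg (mul_nonpos_of_nonpos_of_nonneg hC.le (by positivity)) hg0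
          exact this.trans (by positivity)
    _ = T_a ^ 2 * ((∫ x, psi1 x) * ∫ u, gW W u) * (T_a / |ζ|) ^ 4 := by ring

/-! ## §2. Elementary inequalities used in the assembly -/

/-- `√(a+b) ≤ √a + √b` in `rpow` form. [folklore] -/
theorem rpow_half_add_le {a b : ℝ} (ha : 0 ≤ a) (hb : 0 ≤ b) :
    (a + b) ^ (1 / 2 : ℝ) ≤ a ^ (1 / 2 : ℝ) + b ^ (1 / 2 : ℝ) := by
  rw [← Real.sqrt_eq_rpow, ← Real.sqrt_eq_rpow, ← Real.sqrt_eq_rpow]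
  rw [Real.sqrt_le_left (by positivity)]
  have := Real.sq_sqrt ha
  have := Real.sq_sqrt hb
  nlinarith [Real.sqrt_nonneg a, Real.sqrt_nonneg b]

/-- `(x²)^{1/2} = x` for `x ≥ 0`. [folklore] -/
theorem sq_rpow_half {x : ℝ} (hx : 0 ≤ x) : (x ^ 2) ^ (1 / 2 : ℝ) = x := by
  rw [← Real.sqrt_eq_rpow, Real.sqrt_sq hx]

/-- `(4J₁)^{1/4} J₂^{1/4} ≤ 2 Y^{1/2}` if `0 ≤ J₁, J₂ ≤ Y`. [folklore] -/
theorem quarter_powers_le {J₁ J₂ Y : ℝ} (hJ₁ : 0 ≤ J₁) (_hJ₂ : 0 ≤ J₂) (h1 : J₁ ≤ Y) (_h2 : J₂ ≤ Y) :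
    (4 * J₁) ^ (1 / 4 : ℝ) * J₂ ^ (1 / 4 : ℝ) ≤ 2 * Y ^ (1 / 2 : ℝ) := by
  have hY : 0 ≤ Y := hJ₁.trans h1
  calc (4 * J₁) ^ (1 / 4 : ℝ) * J₂ ^ (1 / 4 : ℝ) ≤ (4 * Y) ^ (1 / 4 : ℝ) * Y ^ (1 / 4 : ℝ) := by
        gcongr
    _ = (4 : ℝ) ^ (1 / 4 : ℝ) * (Y ^ (1 / 4 : ℝ) * Y ^ (1 / 4 : ℝ)) := by
        rw [Real.mul_rpow (by norm_num) hY]; ring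
    _ = (4 : ℝ) ^ (1 / 4 : ℝ) * Y ^ (1 / 2 : ℝ) := by
        rw [← Real.rpow_add_of_nonneg hY (by norm_num) (by norm_num)]; norm_num
    _ ≤ 2 * Y ^ (1 / 2 : ℝ) := by
        refine mul_le_mul_of_nonneg_right ?_ (by positivity)
        calc (4 : ℝ) ^ (1 / 4 : ℝ) ≤ (4 : ℝ) ^ (1 / 2 : ℝ) :=
              Real.rpow_le_rpow_of_exponent_le (by norm_num) (by norm_num)
          _ = 2 := by rw [show (4 : ℝ) = 2 ^ 2 by norm_num, sq_rpow_half (by norm_num)]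

/-- `K^{1/2} K = K^{3/2}` for `K ≥ 0`. [folklore] -/
theorem rpow_half_mul_self {K : ℝ} (hK : 0 ≤ K) : K ^ (1 / 2 : ℝ) * K = K ^ (3 / 2 : ℝ) := by
  rw [show (3 / 2 : ℝ) = 1 / 2 + 1 by norm_num, Real.rpow_add_of_nonneg hK (by norm_num) (by norm_num), Real.rpow_one]

/-- `K³ ≤ 4T² K^{3/2}` when `0 ≤ K ≤ 2T`, `T ≥ 1`. [folklore] -/
theorem cube_le {K T : ℝ} (hK : 0 ≤ K) (_hT : 1 ≤ T) (hKT : K ≤ 2 * T) : K ^ 3 ≤ 4 * T ^ 2 * K ^ (3 / 2 : ℝ) := by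
  have e : K ^ 3 = K ^ (3 / 2 : ℝ) * K ^ (3 / 2 : ℝ) := by
    rw [← Real.rpow_add_of_nonneg hK (by norm_num) (by norm_num)]; norm_num
  rw [e]
  refine mul_le_mul_of_nonneg_right ?_ (by positivity)
  calc K ^ (3 / 2 : ℝ) ≤ (2 * T) ^ (3 / 2 : ℝ) := Real.rpow_le_rpow hK hKT (by norm_num)
    _ ≤ (2 * T) ^ (2 : ℝ) := Real.rpow_le_rpow_of_exponent_le (by linarith) (by norm_num)
    _ = 4 * T ^ 2 := by rw [Real.rpow_two]; ring

/-- `c^{1/2} ≤ c` for `c ≥ 1`. [folklore] -/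
theorem rpow_half_le_self {c : ℝ} (hc : 1 ≤ c) : c ^ (1 / 2 : ℝ) ≤ c := by
  calc c ^ (1 / 2 : ℝ) ≤ c ^ (1 : ℝ) := Real.rpow_le_rpow_of_exponent_le hc (by norm_num)
    _ = c := Real.rpow_one c

/-! ## §3. The arithmetic of one main block -/

set_option maxHeartbeats 3200000 in
/-- **The main-block inequality** (pure real arithmetic): with `𝒯 = T²K^{3/2} + TNK^{1/2}E^{1/2}`, the output
of `block_sum_le_*` combined with Proposition 9.1 and the moment bounds is `≤ A₁ L⁴ 𝒯`.
[cite: GuthMaynard2026, proof of Proposition 10.1 (the display ending in `N²M²|W|^{3/2} + N²M|W|^{1/2}E(W)^{1/2}`)] -/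
theorem main_block_alg {K E T N L Mx G1 G2 J₁ J₂ C_b C₂ C₄ C₉ P₁ Θ ρ : ℝ}
    (hK : 0 ≤ K) (_hKT : K ≤ 2 * T) (hE : 0 ≤ E) (_hT : 1 ≤ T) (_hN : 1 ≤ N)
    (hL : 1 ≤ L) (_hMx : 1 ≤ Mx) (hNMx : N * Mx ≤ 3 * T * L)
    (hG1 : 0 ≤ G1) (hG1K : G1 ≤ C₂ * K) (hG2 : 0 ≤ G2) (hρ0 : 0 ≤ ρ) (hρ : ρ * N ^ 2 ≤ 1)
    (hG2E : G2 ≤ C₄ * L * E + C₄ * ρ * K ^ 4)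
    (_hC_b : 0 ≤ C_b) (hC₂ : 1 ≤ C₂) (hC₄ : 1 ≤ C₄) (hC₉ : 1 ≤ C₉) (_hP₁ : 1 ≤ P₁) (hΘ0 : 0 ≤ Θ)
    (hΘ : Θ ^ (1 / 2 : ℝ) ≤ 7 * L) (hJ₁ : 0 ≤ J₁) (hJ₂ : 0 ≤ J₂)
    (hJ₁b : J₁ ≤ C₉ * Θ * ((16 * Mx) ^ 6 * (P₁ * G1) ^ 2 + (16 * Mx) ^ 4 * (P₁ ^ 2 * G2)))
    (hJ₂b : J₂ ≤ C₉ * Θ * ((16 * Mx) ^ 6 * (P₁ * G1) ^ 2 + (16 * Mx) ^ 4 * (P₁ ^ 2 * G2))) :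
    C_b * (N ^ 2 * L / Mx) * (G1 ^ (1 / 2 : ℝ) * (4 * J₁) ^ (1 / 4 : ℝ) * J₂ ^ (1 / 4 : ℝ)) ≤
      (10 ^ 6 * C_b * C₂ ^ 2 * C₉ * P₁ * C₄) * L ^ 4 *
        (T ^ 2 * K ^ (3 / 2 : ℝ) + T * N * K ^ (1 / 2 : ℝ) * E ^ (1 / 2 : ℝ)) := by
  have hT0 : 0 < T := by linarith
  have hN0 : 0 < N := by linarith
  have hMx0 : 0 < Mx := by linarith
  have hMxne : Mx ≠ 0 := hMx0.ne'
  have hL0 : 0 < L := by linarith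
  have hC₂0 : 0 ≤ C₂ := by linarith
  have hC₄0 : 0 ≤ C₄ := by linarith
  have hC₉0 : 0 ≤ C₉ := by linarith
  have hP₁0 : 0 ≤ P₁ := by linarith
  set Z : ℝ := (16 * Mx) ^ 6 * (P₁ * G1) ^ 2 + (16 * Mx) ^ 4 * (P₁ ^ 2 * G2) with hZ
  have hZ0 : 0 ≤ Z := by rw [hZ]; positivity
  set Y : ℝ := C₉ * Θ * Z with hY
  have : 0 ≤ Y := by rw [hY]; positivity
  -- abbreviations for the `rpow` atoms
  set s₂ : ℝ := C₂ ^ (1 / 2 : ℝ) with hs₂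
  set s₄ : ℝ := C₄ ^ (1 / 2 : ℝ) with hs₄
  set s₉ : ℝ := C₉ ^ (1 / 2 : ℝ) with hs₉
  set k₁ : ℝ := K ^ (1 / 2 : ℝ) with hk₁
  set k₃ : ℝ := K ^ (3 / 2 : ℝ) with hk₃
  set e : ℝ := E ^ (1 / 2 : ℝ) with he
  set r : ℝ := ρ ^ (1 / 2 : ℝ) with hr
  have : 0 ≤ s₂ := by rw [hs₂]; positivity
  have : 0 ≤ s₄ := by rw [hs₄]; positivity
  have : 0 ≤ s₉ := by rw [hs₉]; positivity
  have : 0 ≤ k₁ := by rw [hk₁]; positivity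
  have : 0 ≤ k₃ := by rw [hk₃]; positivity
  have : 0 ≤ e := by rw [he]; positivity
  have : 0 ≤ r := by rw [hr]; positivity
  have hs₂le : s₂ ≤ C₂ := rpow_half_le_self hC₂
  have hs₄le : s₄ ≤ C₄ := rpow_half_le_self hC₄
  have hs₉le : s₉ ≤ C₉ := rpow_half_le_self hC₉
  have hk₁k : k₁ * K = k₃ := rpow_half_mul_self hK
  -- Step 1: `(4J₁)^{1/4}J₂^{1/4} ≤ 2 Y^{1/2} = 2 s₉ Θ^{1/2} Z^{1/2}`
  have h1 : (4 * J₁) ^ (1 / 4 : ℝ) * J₂ ^ (1 / 4 : ℝ) ≤ 2 * Y ^ (1 / 2 : ℝ) := quarter_powers_le hJ₁ hJ₂ hJ₁b hJ₂b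
  have hY_split : Y ^ (1 / 2 : ℝ) = s₉ * Θ ^ (1 / 2 : ℝ) * Z ^ (1 / 2 : ℝ) := by
    rw [hY, Real.mul_rpow (by positivity) hZ0, Real.mul_rpow hC₉0 hΘ0]
  -- Step 2: `Z^{1/2} ≤ (16Mx)³ P₁ G1 + (16Mx)² P₁ G2^{1/2}`
  have h2 : Z ^ (1 / 2 : ℝ) ≤ (16 * Mx) ^ 3 * (P₁ * G1) + (16 * Mx) ^ 2 * P₁ * G2 ^ (1 / 2 : ℝ) := by
    refine (rpow_half_add_le (by positivity) (by positivity)).trans ?_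
    have e1 : ((16 * Mx) ^ 6 * (P₁ * G1) ^ 2) ^ (1 / 2 : ℝ) = (16 * Mx) ^ 3 * (P₁ * G1) := by
      rw [show (16 * Mx) ^ 6 * (P₁ * G1) ^ 2 = ((16 * Mx) ^ 3 * (P₁ * G1)) ^ 2 by ring, sq_rpow_half (by positivity)]
    have e2 : ((16 * Mx) ^ 4 * (P₁ ^ 2 * G2)) ^ (1 / 2 : ℝ) = (16 * Mx) ^ 2 * P₁ * G2 ^ (1 / 2 : ℝ) := by
      rw [show (16 * Mx) ^ 4 * (P₁ ^ 2 * G2) = ((16 * Mx) ^ 2 * P₁) ^ 2 * G2 by ring,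
        Real.mul_rpow (by positivity) hG2, sq_rpow_half (by positivity)]
    rw [e1, e2]
  -- Step 3: `G2^{1/2} ≤ s₄ (L e + r K²)`
  have h3 : G2 ^ (1 / 2 : ℝ) ≤ s₄ * (L * e + r * K ^ 2) := by
    calc G2 ^ (1 / 2 : ℝ) ≤ (C₄ * L * E + C₄ * ρ * K ^ 4) ^ (1 / 2 : ℝ) := Real.rpow_le_rpow hG2 hG2E (by norm_num)
      _ ≤ (C₄ * L * E) ^ (1 / 2 : ℝ) + (C₄ * ρ * K ^ 4) ^ (1 / 2 : ℝ) := rpow_half_add_le (by positivity) (by positivity)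
      _ = s₄ * (L ^ (1 / 2 : ℝ) * e) + s₄ * (r * K ^ 2) := by
          rw [Real.mul_rpow (by positivity) hE, Real.mul_rpow hC₄0 hL0.le,
            Real.mul_rpow (by positivity) (by positivity), Real.mul_rpow hC₄0 hρ0,
            show K ^ 4 = (K ^ 2) ^ 2 by ring, sq_rpow_half (by positivity)]
          ring
      _ ≤ s₄ * (L * e) + s₄ * (r * K ^ 2) := by
          gcongr
          calc L ^ (1 / 2 : ℝ) ≤ L ^ (1 : ℝ) := Real.rpow_le_rpow_of_exponent_le hL (by norm_num)
            _ = L := Real.rpow_one L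
      _ = _ := by ring
  -- Step 4: `r N ≤ 1`
  have h4 : r * N ≤ 1 := by
    have : (ρ * N ^ 2) ^ (1 / 2 : ℝ) ≤ 1 := by
      calc (ρ * N ^ 2) ^ (1 / 2 : ℝ) ≤ (1 : ℝ) ^ (1 / 2 : ℝ) := Real.rpow_le_rpow (by positivity) hρ (by norm_num)
        _ = 1 := Real.one_rpow _
    rwa [Real.mul_rpow hρ0 (by positivity), sq_rpow_half hN0.le] at this
  -- Step 5: `G1^{1/2} ≤ s₂ k₁`
  have hG1h : G1 ^ (1 / 2 : ℝ) ≤ s₂ * k₁ := by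
    rw [hs₂, hk₁, ← Real.mul_rpow hC₂0 hK]; exact Real.rpow_le_rpow hG1 hG1K (by norm_num)
  -- Step 6: the left-hand side, bounded by a polynomial expression in the atoms
  have hA : (4 * J₁) ^ (1 / 4 : ℝ) * J₂ ^ (1 / 4 : ℝ) ≤
      2 * (s₉ * (7 * L) * ((16 * Mx) ^ 3 * (P₁ * (C₂ * K)) + (16 * Mx) ^ 2 * P₁ * (s₄ * (L * e + r * K ^ 2)))) := by
    refine h1.trans ?_
    rw [hY_split]
    have hZb : Z ^ (1 / 2 : ℝ) ≤ (16 * Mx) ^ 3 * (P₁ * (C₂ * K)) + (16 * Mx) ^ 2 * P₁ * (s₄ * (L * e + r * K ^ 2)) := by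
      refine h2.trans ?_
      exact add_le_add (mul_le_mul_of_nonneg_left (mul_le_mul_of_nonneg_left hG1K hP₁0) (by positivity))
        (mul_le_mul_of_nonneg_left h3 (by positivity))
    have hΘL : s₉ * Θ ^ (1 / 2 : ℝ) * Z ^ (1 / 2 : ℝ) ≤
        s₉ * (7 * L) * ((16 * Mx) ^ 3 * (P₁ * (C₂ * K)) + (16 * Mx) ^ 2 * P₁ * (s₄ * (L * e + r * K ^ 2))) :=
      mul_le_mul (mul_le_mul_of_nonneg_left hΘ (by positivity)) hZb (Real.rpow_nonneg hZ0 _) (by positivity)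
    exact mul_le_mul_of_nonneg_left hΘL (by norm_num)
  have hLHS : C_b * (N ^ 2 * L / Mx) * (G1 ^ (1 / 2 : ℝ) * (4 * J₁) ^ (1 / 4 : ℝ) * J₂ ^ (1 / 4 : ℝ)) ≤
      C_b * (N ^ 2 * L / Mx) * ((s₂ * k₁) *
        (2 * (s₉ * (7 * L) * ((16 * Mx) ^ 3 * (P₁ * (C₂ * K)) + (16 * Mx) ^ 2 * P₁ * (s₄ * (L * e + r * K ^ 2)))))) := by
    have hprod : G1 ^ (1 / 2 : ℝ) * (4 * J₁) ^ (1 / 4 : ℝ) * J₂ ^ (1 / 4 : ℝ) ≤ (s₂ * k₁) *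
        (2 * (s₉ * (7 * L) * ((16 * Mx) ^ 3 * (P₁ * (C₂ * K)) + (16 * Mx) ^ 2 * P₁ * (s₄ * (L * e + r * K ^ 2))))) := by
      rw [mul_assoc]
      exact mul_le_mul hG1h hA (by positivity) (by positivity)
    exact mul_le_mul_of_nonneg_left hprod (by positivity)
  refine hLHS.trans ?_
  -- Step 7: clear the denominator
  have eq1 : C_b * (N ^ 2 * L / Mx) * ((s₂ * k₁) *
      (2 * (s₉ * (7 * L) * ((16 * Mx) ^ 3 * (P₁ * (C₂ * K)) + (16 * Mx) ^ 2 * P₁ * (s₄ * (L * e + r * K ^ 2)))))) =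
      14 * C_b * s₂ * s₉ * L ^ 2 *
        (4096 * P₁ * C₂ * (N ^ 2 * Mx ^ 2) * (k₁ * K) +
          256 * P₁ * s₄ * (N ^ 2 * Mx) * k₁ * (L * e + r * K ^ 2)) := by
    field_simp; ring
  rw [eq1, hk₁k]
  -- Step 8: monomial inequalities
  have hNM2 : N ^ 2 * Mx ^ 2 ≤ 9 * T ^ 2 * L ^ 2 := by
    have h := mul_le_mul hNMx hNMx (by positivity) (by positivity)
    nlinarith [h]
  have hNM1 : N ^ 2 * Mx ≤ 3 * T * L * N := by
    have h := mul_le_mul_of_nonneg_left hNMx hN0.le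
    nlinarith [h]
  have h5 : (N ^ 2 * Mx) * (r * k₁ * K ^ 2) ≤ (3 * T * L) * (2 * T) * k₃ := by
    calc (N ^ 2 * Mx) * (r * k₁ * K ^ 2)
        ≤ (3 * T * L * N) * (r * k₁ * K ^ 2) := by gcongr
      _ = (3 * T * L) * (r * N) * K * (k₁ * K) := by ring
      _ ≤ (3 * T * L) * 1 * (2 * T) * (k₁ * K) := by gcongr
      _ = _ := by rw [hk₁k]; ring
  -- products with the non-negative coefficients
  have f1 : 14 * C_b * s₂ * s₉ * L ^ 2 * (4096 * P₁ * C₂ * (N ^ 2 * Mx ^ 2) * k₃) ≤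
      14 * C_b * s₂ * s₉ * L ^ 2 * (4096 * P₁ * C₂ * (9 * T ^ 2 * L ^ 2) * k₃) := by gcongr
  have f2 : 14 * C_b * s₂ * s₉ * L ^ 2 * (256 * P₁ * s₄ * (N ^ 2 * Mx) * k₁ * (L * e)) ≤
      14 * C_b * s₂ * s₉ * L ^ 2 * (256 * P₁ * s₄ * (3 * T * L * N) * k₁ * (L * e)) := by gcongr
  have f3 : 14 * C_b * s₂ * s₉ * L ^ 2 * (256 * P₁ * s₄ * ((N ^ 2 * Mx) * (r * k₁ * K ^ 2))) ≤
      14 * C_b * s₂ * s₉ * L ^ 2 * (256 * P₁ * s₄ * ((3 * T * L) * (2 * T) * k₃)) := by gcongr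
  -- replace the square roots of the constants by the constants, and `L³` by `L⁴`
  have hL3 : L ^ 3 ≤ L ^ 4 := pow_le_pow_right₀ hL (by norm_num)
  have g1 : 14 * C_b * s₂ * s₉ * L ^ 2 * (4096 * P₁ * C₂ * (9 * T ^ 2 * L ^ 2) * k₃) ≤
      516096 * (C_b * C₂ ^ 2 * C₉ * P₁ * C₄) * L ^ 4 * (T ^ 2 * k₃) := by
    calc 14 * C_b * s₂ * s₉ * L ^ 2 * (4096 * P₁ * C₂ * (9 * T ^ 2 * L ^ 2) * k₃)
        = 516096 * (C_b * (s₂ * C₂) * s₉ * P₁ * 1) * L ^ 4 * (T ^ 2 * k₃) := by ring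
      _ ≤ 516096 * (C_b * (C₂ * C₂) * C₉ * P₁ * C₄) * L ^ 4 * (T ^ 2 * k₃) := by gcongr
      _ = _ := by ring
  have g2 : 14 * C_b * s₂ * s₉ * L ^ 2 * (256 * P₁ * s₄ * (3 * T * L * N) * k₁ * (L * e)) ≤
      10752 * (C_b * C₂ ^ 2 * C₉ * P₁ * C₄) * L ^ 4 * (T * N * k₁ * e) := by
    calc 14 * C_b * s₂ * s₉ * L ^ 2 * (256 * P₁ * s₄ * (3 * T * L * N) * k₁ * (L * e))
        = 10752 * (C_b * (s₂ * 1) * s₉ * P₁ * s₄) * L ^ 4 * (T * N * k₁ * e) := by ring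
      _ ≤ 10752 * (C_b * (C₂ * C₂) * C₉ * P₁ * C₄) * L ^ 4 * (T * N * k₁ * e) := by gcongr
      _ = _ := by ring
  have g3 : 14 * C_b * s₂ * s₉ * L ^ 2 * (256 * P₁ * s₄ * ((3 * T * L) * (2 * T) * k₃)) ≤
      21504 * (C_b * C₂ ^ 2 * C₉ * P₁ * C₄) * L ^ 4 * (T ^ 2 * k₃) := by
    calc 14 * C_b * s₂ * s₉ * L ^ 2 * (256 * P₁ * s₄ * ((3 * T * L) * (2 * T) * k₃))
        = 21504 * (C_b * (s₂ * 1) * s₉ * P₁ * s₄) * L ^ 3 * (T ^ 2 * k₃) := by ring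
      _ ≤ 21504 * (C_b * (C₂ * C₂) * C₉ * P₁ * C₄) * L ^ 3 * (T ^ 2 * k₃) := by gcongr
      _ ≤ 21504 * (C_b * (C₂ * C₂) * C₉ * P₁ * C₄) * L ^ 4 * (T ^ 2 * k₃) :=
          mul_le_mul_of_nonneg_right (mul_le_mul_of_nonneg_left hL3 (by positivity)) (by positivity)
      _ = _ := by ring
  have hpos1 : 0 ≤ (C_b * C₂ ^ 2 * C₉ * P₁ * C₄) * L ^ 4 * (T ^ 2 * k₃) := by positivity
  have hpos2 : 0 ≤ (C_b * C₂ ^ 2 * C₉ * P₁ * C₄) * L ^ 4 * (T * N * k₁ * e) := by positivity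
  have hexpand : 14 * C_b * s₂ * s₉ * L ^ 2 *
      (4096 * P₁ * C₂ * (N ^ 2 * Mx ^ 2) * k₃ + 256 * P₁ * s₄ * (N ^ 2 * Mx) * k₁ * (L * e + r * K ^ 2)) =
      14 * C_b * s₂ * s₉ * L ^ 2 * (4096 * P₁ * C₂ * (N ^ 2 * Mx ^ 2) * k₃) +
      14 * C_b * s₂ * s₉ * L ^ 2 * (256 * P₁ * s₄ * (N ^ 2 * Mx) * k₁ * (L * e)) +
      14 * C_b * s₂ * s₉ * L ^ 2 * (256 * P₁ * s₄ * ((N ^ 2 * Mx) * (r * k₁ * K ^ 2))) := by ring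
  rw [hexpand]
  have htarget : (10 ^ 6 * C_b * C₂ ^ 2 * C₉ * P₁ * C₄) * L ^ 4 * (T ^ 2 * k₃ + T * N * k₁ * e) =
      10 ^ 6 * ((C_b * C₂ ^ 2 * C₉ * P₁ * C₄) * L ^ 4 * (T ^ 2 * k₃)) +
      10 ^ 6 * ((C_b * C₂ ^ 2 * C₉ * P₁ * C₄) * L ^ 4 * (T * N * k₁ * e)) := by ring
  rw [htarget]
  linarith [f1, f2, f3, g1, g2, g3]

/-! ## §4. One main block -/

set_option maxHeartbeats 3200000 in
/-- **One main block** `shell ia × shell ib × shell i₃` (or its swap), `ia ≤ ib`, `i₃ ≤ ib + 4`, localised at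
the scale `B = N2^{ib}N^{-η}`: the analytic bound of `block_sum_le_*` is at most `A₁ N^{4η} 𝒯`,
`𝒯 = T²|W|^{3/2} + TN|W|^{1/2}E(W)^{1/2}`, once Proposition 9.1 (for `f_B`, admissible by Lemma 8.4) and
the moment bounds of Lemmas 8.2–8.3 are inserted.
[cite: GuthMaynard2026, proof of Proposition 10.1] -/
theorem main_block {η C₉ T₉ C_F C₂ C₄ C_b : ℝ} {j : ℕ} (hη0 : 0 < η) (hη12 : η ≤ 1 / 2)
    (hC₉1 : 1 ≤ C₉)
    (hC₉ : ∀ T : ℝ, T₉ ≤ T → ∀ M : ℝ, 1 ≤ M → M ≤ T →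
      ∀ f : ℝ → ℝ, ContDiff ℝ ∞ f → HasCompactSupport f → (∀ x, 0 ≤ f x) →
      (∀ x, f x ≠ 0 → 1 / 16 ≤ x ∧ x ≤ 9 / 2) →
      (∀ ζ : ℝ, ζ ≠ 0 → ‖𝓕 (fun y ↦ ((f y : ℝ) : ℂ)) ζ‖ ≤ T ^ 2 * (∫ y, f y) * (T / |ζ|) ^ 4) →
      ∀ (I₁ I₂ : Finset ℤ) (M₁ M₂ : ℝ) (M₃ : ℕ), 1 ≤ M₁ → M₁ ≤ M → 1 ≤ M₂ → M₂ ≤ M → (M₃ : ℝ) ≤ 23 * M →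
      (∀ m ∈ I₁, M₁ ≤ |(m : ℝ)| ∧ |(m : ℝ)| ≤ 2 * M₁) → (∀ m ∈ I₂, M₂ ≤ |(m : ℝ)| ∧ |(m : ℝ)| ≤ 2 * M₂) →
      Jfun f I₁ I₂ M₃ ≤ C₉ * T ^ η * (M ^ 6 * (∫ y, f y) ^ 2 + M ^ 4 * ∫ y, f y ^ 2))
    (hCF : ∀ (W : Finset ℝ) (B : ℝ), 0 < B → ∀ ξ : ℝ, ξ ≠ 0 →
      ‖𝓕 (fun x ↦ ((fB W B x : ℝ) : ℂ)) ξ‖ ≤ C_F * (B / |ξ|) ^ 4 * ∫ u, gW W u)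
    (hC₂1 : 1 ≤ C₂) (hC₄1 : 1 ≤ C₄) (hηj : 2 ≤ η * ((j : ℝ) - 1))
    (hC₄ : ∀ (W : Finset ℝ) (D : ℝ), 1 ≤ D → ∫ u, gW W u ^ 2 ≤ C₄ * D * addEnergy W + C₄ * D / D ^ j * (W.card : ℝ) ^ 4)
    (hC_b0 : 0 ≤ C_b)
    {N : ℕ} (hN : (2304 : ℝ) ≤ N) (hNT₉ : T₉ ≤ N) (hNCF : C_F ≤ (∫ x, psi1 x) * N)
    (W : Finset ℝ) (hC₂W : ∫ u, gW W u ≤ C₂ * W.card) (hKT : (W.card : ℝ) ≤ 2 * (N : ℝ) ^ (6 / 5 : ℝ))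
    {M₀ : ℕ} (hNM₀ : (N : ℝ) * M₀ ≤ 3 * (N : ℝ) ^ (6 / 5 : ℝ) * (N : ℝ) ^ η)
    {ia ib i₃ : ℕ} (hia : ia ≤ ib) (hi₃ : i₃ ≤ ib + 4) (hib : (2 : ℝ) ^ ib ≤ M₀) :
    C_b * ((N : ℝ) ^ 3 / ((N : ℝ) * 2 ^ ib / (N : ℝ) ^ η)) *
        ((∫ u, gW W u) ^ (1 / 2 : ℝ) *
          (4 * Jfun (fB W ((N : ℝ) * 2 ^ ib / (N : ℝ) ^ η)) (shell M₀ i₃) (shell M₀ ib) (2 ^ (ia + 1))) ^ (1 / 4 : ℝ) *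
          (Jfun (fB W ((N : ℝ) * 2 ^ ib / (N : ℝ) ^ η)) (shell M₀ ia) (shell M₀ ib) (2 ^ (i₃ + 1))) ^ (1 / 4 : ℝ)) ≤
      (10 ^ 6 * C_b * C₂ ^ 2 * C₉ * (max (∫ x, psi1 x) 1) * C₄) * ((N : ℝ) ^ η) ^ 4 *
        (((N : ℝ) ^ (6 / 5 : ℝ)) ^ 2 * (W.card : ℝ) ^ (3 / 2 : ℝ) +
          (N : ℝ) ^ (6 / 5 : ℝ) * N * (W.card : ℝ) ^ (1 / 2 : ℝ) * (addEnergy W) ^ (1 / 2 : ℝ)) := by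
  -- basic quantities
  have hn1 : (1 : ℝ) ≤ N := by linarith
  have hn0 : (0 : ℝ) < N := by linarith
  have hnle : ∀ {x y : ℝ}, x ≤ y → (N : ℝ) ^ x ≤ (N : ℝ) ^ y := fun h ↦ Real.rpow_le_rpow_of_exponent_le hn1 h
  have hnp : ∀ x y : ℝ, (N : ℝ) ^ x * (N : ℝ) ^ y = (N : ℝ) ^ (x + y) := fun x y ↦ (Real.rpow_add hn0 x y).symm
  set T : ℝ := (N : ℝ) ^ (6 / 5 : ℝ) with hT
  have hT1 : 1 ≤ T := Real.one_le_rpow hn1 (by norm_num)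
  have hT0 : 0 < T := by linarith
  have hNT : (N : ℝ) ≤ T := by
    calc (N : ℝ) = (N : ℝ) ^ (1 : ℝ) := (Real.rpow_one _).symm
      _ ≤ T := hnle (by norm_num)
  set L : ℝ := (N : ℝ) ^ η with hL
  have hL1 : 1 ≤ L := Real.one_le_rpow hn1 hη0.le
  have hL0 : 0 < L := by linarith
  have hLhalf : L ≤ (N : ℝ) ^ (1 / 2 : ℝ) := hnle hη12
  set K : ℝ := (W.card : ℝ) with hK
  have hK0 : 0 ≤ K := Nat.cast_nonneg _
  set E : ℝ := addEnergy W with hE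
  have hE0 : 0 ≤ E := addEnergy_nonneg W
  set P₁ : ℝ := ∫ x, psi1 x with hP₁
  have hP₁0 : 0 < P₁ := integral_psi1_pos
  set P₁' : ℝ := max P₁ 1 with hP₁'
  have hP₁'1 : 1 ≤ P₁' := le_max_right _ _
  have hP₁le : P₁ ≤ P₁' := le_max_left _ _
  set Mx : ℝ := (2 : ℝ) ^ ib with hMx
  have hMx1 : 1 ≤ Mx := one_le_pow₀ (by norm_num)
  have hMx0 : 0 < Mx := by linarith
  set B : ℝ := (N : ℝ) * Mx / L with hB
  have hB0 : 0 < B := by rw [hB]; positivity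
  have hNMx : (N : ℝ) * Mx ≤ 3 * T * L := (mul_le_mul_of_nonneg_left hib hn0.le).trans hNM₀
  -- `B ≥ 48` and `B ≤ T_a`
  have hBlo : 48 ≤ B := by
    have h1 : (N : ℝ) ^ (1 / 2 : ℝ) ≤ B := by
      rw [hB, le_div_iff₀ hL0]
      calc (N : ℝ) ^ (1 / 2 : ℝ) * L ≤ (N : ℝ) ^ (1 / 2 : ℝ) * (N : ℝ) ^ (1 / 2 : ℝ) := by gcongr
        _ = (N : ℝ) * 1 := by rw [hnp]; norm_num
        _ ≤ (N : ℝ) * Mx := by gcongr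
    have h2 : (48 : ℝ) ≤ (N : ℝ) ^ (1 / 2 : ℝ) := by
      have : ((2304 : ℝ)) ^ (1 / 2 : ℝ) ≤ (N : ℝ) ^ (1 / 2 : ℝ) := Real.rpow_le_rpow (by norm_num) hN (by norm_num)
      rwa [show (2304 : ℝ) = 48 ^ 2 by norm_num, sq_rpow_half (by norm_num)] at this
    linarith
  set T_a : ℝ := 48 * T * L with hT_a
  have hBTa : B ≤ T_a := by
    have : B ≤ (N : ℝ) * Mx := by
      rw [hB, div_le_iff₀ hL0]
      calc (N : ℝ) * Mx = (N : ℝ) * Mx * 1 := (mul_one _).symm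
        _ ≤ (N : ℝ) * Mx * L := by gcongr
    linarith
  have hTaN : (N : ℝ) ≤ T_a := by
    have : T * L ≥ N * 1 := mul_le_mul hNT hL1 zero_le_one hT0.le
    linarith
  have hTaT₉ : T₉ ≤ T_a := hNT₉.trans hTaN
  have hCFTa : C_F ≤ P₁ * T_a ^ 2 := by
    refine hNCF.trans (mul_le_mul_of_nonneg_left ?_ hP₁0.le)
    calc (N : ℝ) ≤ T_a := hTaN
      _ = T_a * 1 := (mul_one _).symm
      _ ≤ T_a * T_a := by gcongr; linarith
      _ = T_a ^ 2 := (sq T_a).symm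
  -- the function `f_B` and its class properties
  set f : ℝ → ℝ := fB W B with hf
  have hfc : ContDiff ℝ ∞ f := fB_contDiff W hB0
  have hfs : HasCompactSupport f := hasCompactSupport_fB W hB0
  have hf0 : ∀ x, 0 ≤ f x := fB_nonneg W hB0.le
  have hfS : ∀ x, f x ≠ 0 → 1 / 16 ≤ x ∧ x ≤ 9 / 2 := fun x hx ↦ fB_support W hBlo hx
  have hfdec : ∀ ζ : ℝ, ζ ≠ 0 → ‖𝓕 (fun y ↦ ((f y : ℝ) : ℂ)) ζ‖ ≤ T_a ^ 2 * (∫ y, f y) * (T_a / |ζ|) ^ 4 :=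
    fun ζ hζ ↦ fB_decay_class hCF W hB0 hBTa hCFTa hζ
  -- moments
  set G1 : ℝ := ∫ u, gW W u with hG1
  set G2 : ℝ := ∫ u, gW W u ^ 2 with hG2
  have hG10 : 0 ≤ G1 := integral_nonneg (gW_nonneg W)
  have hG20 : 0 ≤ G2 := integral_nonneg fun u ↦ sq_nonneg _
  have hf1 : ∫ y, f y = P₁ * G1 := integral_fB W hB0
  have hf2 : ∫ y, f y ^ 2 ≤ P₁ ^ 2 * G2 := integral_fB_sq_le W hB0
  set ρ : ℝ := L / L ^ j with hρ
  have hρ0 : 0 ≤ ρ := by rw [hρ]; positivity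
  have hG2E : G2 ≤ C₄ * L * E + C₄ * ρ * K ^ 4 := by
    have := hC₄ W L hL1
    simp only [hρ]
    calc G2 ≤ C₄ * L * E + C₄ * L / L ^ j * K ^ 4 := this
      _ = C₄ * L * E + C₄ * (L / L ^ j) * K ^ 4 := by ring
  have hρN : ρ * (N : ℝ) ^ 2 ≤ 1 := by
    have e1 : ρ = (N : ℝ) ^ (η - η * j) := by
      rw [hρ, hL, ← Real.rpow_natCast, ← Real.rpow_mul hn0.le, ← Real.rpow_sub hn0]
    rw [e1, show ((N : ℝ)) ^ 2 = (N : ℝ) ^ (2 : ℝ) by norm_cast, hnp]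
    calc (N : ℝ) ^ (η - η * j + 2) ≤ (N : ℝ) ^ (0 : ℝ) := hnle (by nlinarith)
      _ = 1 := Real.rpow_zero _
  -- Proposition 9.1 for the two configurations, with `M = 16 Mx`
  set M : ℝ := 16 * Mx with hM
  have hM1 : 1 ≤ M := by simp only [hM]; linarith
  have hMTa : M ≤ T_a := by
    have h1 : Mx ≤ 3 * T * L := by
      calc Mx = 1 * Mx := (one_mul _).symm
        _ ≤ (N : ℝ) * Mx := by gcongr
        _ ≤ 3 * T * L := hNMx
    simp only [hM, hT_a]; linarith
  have hshell : ∀ i : ℕ, ∀ m ∈ shell M₀ i, (2 : ℝ) ^ i ≤ |(m : ℝ)| ∧ |(m : ℝ)| ≤ 2 * 2 ^ i :=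
    fun i m hm ↦ shell_bounds hm
  have hpow_le : ∀ {a b : ℕ}, a ≤ b → (2 : ℝ) ^ a ≤ 2 ^ b := fun h ↦ pow_le_pow_right₀ (by norm_num) h
  have hia_M : (2 : ℝ) ^ ia ≤ M := by
    calc (2 : ℝ) ^ ia ≤ 2 ^ ib := hpow_le hia
      _ = 1 * Mx := by rw [one_mul]
      _ ≤ 16 * Mx := by gcongr; norm_num
  have hib_M : (2 : ℝ) ^ ib ≤ M := by
    calc (2 : ℝ) ^ ib = 1 * Mx := by rw [one_mul]
      _ ≤ 16 * Mx := by gcongr; norm_num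
  have hi₃_M : (2 : ℝ) ^ i₃ ≤ M := by
    calc (2 : ℝ) ^ i₃ ≤ 2 ^ (ib + 4) := hpow_le hi₃
      _ = 16 * Mx := by rw [pow_add]; ring
  have htop₃ : (((2 ^ (i₃ + 1) : ℕ)) : ℝ) ≤ 23 * M := by
    push_cast
    calc (2 : ℝ) ^ (i₃ + 1) ≤ 2 ^ (ib + 5) := hpow_le (by omega)
      _ = 32 * Mx := by rw [pow_add]; ring
      _ ≤ 23 * (16 * Mx) := by nlinarith
  have htop₁ : (((2 ^ (ia + 1) : ℕ)) : ℝ) ≤ 23 * M := by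
    push_cast
    calc (2 : ℝ) ^ (ia + 1) ≤ 2 ^ (ib + 1) := hpow_le (by omega)
      _ = 2 * Mx := by rw [pow_succ]; ring
      _ ≤ 23 * (16 * Mx) := by nlinarith
  have hone : ∀ i : ℕ, (1 : ℝ) ≤ 2 ^ i := fun i ↦ one_le_pow₀ (by norm_num)
  have hJ₂ := hC₉ T_a hTaT₉ M hM1 hMTa f hfc hfs hf0 hfS hfdec (shell M₀ ia) (shell M₀ ib) (2 ^ ia) (2 ^ ib)
    (2 ^ (i₃ + 1)) (hone ia) hia_M (hone ib) hib_M htop₃ (hshell ia) (hshell ib)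
  have hJ₁ := hC₉ T_a hTaT₉ M hM1 hMTa f hfc hfs hf0 hfS hfdec (shell M₀ i₃) (shell M₀ ib) (2 ^ i₃) (2 ^ ib)
    (2 ^ (ia + 1)) (hone i₃) hi₃_M (hone ib) hib_M htop₁ (hshell i₃) (hshell ib)
  -- `Θ = T_a^η`, `Θ^{1/2} ≤ 7L`
  set Θ : ℝ := T_a ^ η with hΘ
  have hTa0 : 0 ≤ T_a := by rw [hT_a]; positivity
  have hΘ0 : 0 ≤ Θ := by rw [hΘ]; positivity
  have hΘhalf : Θ ^ (1 / 2 : ℝ) ≤ 7 * L := by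
    -- `T_a ≤ 48 N^{6/5} N^{1/2} ≤ 48 N²`, so `Θ^{1/2} = T_a^{η/2} ≤ (48N²)^{η/2} ≤ 48^{1/4} N^η ≤ 7L`
    have hTa_le : T_a ≤ 48 * (N : ℝ) ^ (2 : ℝ) := by
      simp only [hT_a, hT, hL]
      rw [mul_assoc, hnp]
      refine mul_le_mul_of_nonneg_left (hnle (by linarith)) (by norm_num)
    have eη1 : η * (1 / 2) = η / 2 := by ring
    have eη2 : (2 : ℝ) * (η / 2) = η := by ring
    calc Θ ^ (1 / 2 : ℝ) = T_a ^ (η / 2) := by rw [hΘ, ← Real.rpow_mul hTa0, eη1]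
      _ ≤ (48 * (N : ℝ) ^ (2 : ℝ)) ^ (η / 2) := Real.rpow_le_rpow hTa0 hTa_le (by positivity)
      _ = (48 : ℝ) ^ (η / 2) * (N : ℝ) ^ η := by
          rw [Real.mul_rpow (by norm_num) (by positivity), ← Real.rpow_mul hn0.le, eη2]
      _ ≤ 7 * L := by
          rw [hL]
          refine mul_le_mul_of_nonneg_right ?_ (by positivity)
          calc (48 : ℝ) ^ (η / 2) ≤ (48 : ℝ) ^ (1 / 4 : ℝ) := Real.rpow_le_rpow_of_exponent_le (by norm_num) (by linarith)
            _ ≤ ((7 : ℝ) ^ (4 : ℕ)) ^ (1 / 4 : ℝ) := Real.rpow_le_rpow (by norm_num) (by norm_num) (by norm_num)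
            _ = 7 := by rw [← Real.rpow_natCast, ← Real.rpow_mul (by norm_num)]; norm_num
  -- the `Z`-form of the two `J` bounds
  set Z : ℝ := (16 * Mx) ^ 6 * (P₁' * G1) ^ 2 + (16 * Mx) ^ 4 * (P₁' ^ 2 * G2) with hZ
  have hZJ : C₉ * T_a ^ η * (M ^ 6 * (∫ y, f y) ^ 2 + M ^ 4 * ∫ y, f y ^ 2) ≤ C₉ * Θ * Z := by
    simp only [hΘ, hZ, hM]
    refine mul_le_mul_of_nonneg_left ?_ (by positivity)
    rw [hf1]
    have h1 : (P₁ * G1) ^ 2 ≤ (P₁' * G1) ^ 2 := by gcongr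
    have h2 : ∫ y, f y ^ 2 ≤ P₁' ^ 2 * G2 := hf2.trans (by gcongr)
    gcongr
  have hJ₁b := hJ₁.trans hZJ
  have hJ₂b := hJ₂.trans hZJ
  have hJ₁0 : 0 ≤ Jfun f (shell M₀ i₃) (shell M₀ ib) (2 ^ (ia + 1)) := integral_nonneg fun u ↦ sq_nonneg _
  have hJ₂0 : 0 ≤ Jfun f (shell M₀ ia) (shell M₀ ib) (2 ^ (i₃ + 1)) := integral_nonneg fun u ↦ sq_nonneg _
  -- `N³/B = N²L/Mx`
  have hNB : (N : ℝ) ^ 3 / B = (N : ℝ) ^ 2 * L / Mx := by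
    rw [hB]
    field_simp
  rw [hNB]
  exact main_block_alg (C_b := C_b) hK0 hKT hE0 hT1 hn1 hL1 hMx1 hNMx hG10 hC₂W hG20 hρ0 hρN hG2E hC_b0 hC₂1
    hC₄1 hC₉1 hP₁'1 hΘ0 hΘhalf hJ₁0 hJ₂0 hJ₁b hJ₂b

/-! ## §5. Proposition 10.1 -/

/-- The number of dyadic scales: `⌊log₂ M₀⌋ + 1 ≤ (1 + 6/η) N^{2η}` for `1 ≤ M₀ ≤ 3N²`.
[folklore] -/
theorem card_range_log_le {η : ℝ} (hη : 0 < η) (hη1 : η ≤ 1) {N : ℕ} (hN : (1 : ℝ) ≤ N) {M₀ : ℕ}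
    (hM₀1 : 1 ≤ M₀) (hM₀ : (M₀ : ℝ) ≤ 3 * (N : ℝ) ^ 2) :
    ((Nat.log 2 M₀ + 1 : ℕ) : ℝ) ≤ (1 + 6 / η) * ((N : ℝ) ^ η) ^ 2 := by
  have hn0 : (0 : ℝ) < N := by linarith
  have hM₀r : (1 : ℝ) ≤ M₀ := by exact_mod_cast hM₀1
  have hM₀0 : (0 : ℝ) < M₀ := by linarith
  -- `Nat.log 2 M₀ ≤ log₂ M₀ ≤ 2 log M₀`
  have h1 : ((Nat.log 2 M₀ : ℕ) : ℝ) ≤ Real.log M₀ / Real.log 2 := by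
    rw [le_div_iff₀ (Real.log_pos one_lt_two), ← Real.log_pow]
    refine Real.log_le_log (by positivity) ?_
    exact_mod_cast Nat.pow_log_le_self 2 (by omega : M₀ ≠ 0)
  have hlog2 : (1 / 2 : ℝ) ≤ Real.log 2 := by
    have := Real.log_two_gt_d9; linarith
  have h2 : Real.log M₀ / Real.log 2 ≤ 2 * Real.log M₀ := by
    rw [div_le_iff₀ (Real.log_pos one_lt_two)]
    have := Real.log_nonneg hM₀r
    nlinarith
  -- `log M₀ ≤ M₀^η/η ≤ 3 N^{2η}/η`
  have h3 : Real.log M₀ ≤ (M₀ : ℝ) ^ η / η := Real.log_le_rpow_div hM₀0.le hη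
  have h4 : (M₀ : ℝ) ^ η ≤ 3 * ((N : ℝ) ^ η) ^ 2 := by
    calc (M₀ : ℝ) ^ η ≤ (3 * (N : ℝ) ^ 2) ^ η := Real.rpow_le_rpow hM₀0.le hM₀ hη.le
      _ = (3 : ℝ) ^ η * ((N : ℝ) ^ η) ^ 2 := by
          rw [Real.mul_rpow (by norm_num) (by positivity), show ((N : ℝ) ^ 2) = (N : ℝ) ^ (2 : ℝ) by norm_cast,
            ← Real.rpow_mul hn0.le, ← Real.rpow_natCast ((N : ℝ) ^ η) 2, ← Real.rpow_mul hn0.le]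
          ring_nf
      _ ≤ 3 * ((N : ℝ) ^ η) ^ 2 := by
          refine mul_le_mul_of_nonneg_right ?_ (by positivity)
          calc (3 : ℝ) ^ η ≤ (3 : ℝ) ^ (1 : ℝ) := Real.rpow_le_rpow_of_exponent_le (by norm_num) hη1
            _ = 3 := Real.rpow_one 3
  have hNη1 : 1 ≤ ((N : ℝ) ^ η) ^ 2 := one_le_pow₀ (Real.one_le_rpow hN hη.le)
  push_cast
  have h5 : ((Nat.log 2 M₀ : ℕ) : ℝ) ≤ 6 / η * ((N : ℝ) ^ η) ^ 2 := by
    calc ((Nat.log 2 M₀ : ℕ) : ℝ) ≤ 2 * Real.log M₀ := h1.trans h2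
      _ ≤ 2 * ((M₀ : ℝ) ^ η / η) := by linarith
      _ ≤ 2 * (3 * ((N : ℝ) ^ η) ^ 2 / η) := by gcongr
      _ = 6 / η * ((N : ℝ) ^ η) ^ 2 := by ring
  nlinarith [h5, div_nonneg (by norm_num : (0:ℝ) ≤ 6) hη.le]

/-- `|𝓜³| ≤ (3M₀)³` (`|𝓜| = 2M₀ ≤ 3M₀`). [folklore] -/
theorem card_Mset3_le {M₀ : ℕ} (hM₀ : 1 ≤ M₀) :
    ((Mset M₀ ×ˢ (Mset M₀ ×ˢ Mset M₀)).card : ℝ) ≤ (3 * (M₀ : ℝ)) ^ 3 := by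
  have hM₀r : (1 : ℝ) ≤ M₀ := by exact_mod_cast hM₀
  have h1 : ((Mset M₀).card : ℝ) ≤ 3 * M₀ := by
    have h2 : (Mset M₀).card ≤ (Finset.Icc (-(M₀ : ℤ)) M₀).card := Finset.card_le_card (Finset.erase_subset _ _)
    have h3 : ((Finset.Icc (-(M₀ : ℤ)) M₀).card : ℝ) = 2 * M₀ + 1 := by
      rw [Int.card_Icc]
      have : ((M₀ : ℤ) + 1 - -(M₀ : ℤ)).toNat = 2 * M₀ + 1 := by omega
      rw [this]; push_cast; ring
    calc ((Mset M₀).card : ℝ) ≤ ((Finset.Icc (-(M₀ : ℤ)) M₀).card : ℝ) := by exact_mod_cast h2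
      _ = 2 * M₀ + 1 := h3
      _ ≤ 3 * M₀ := by linarith
  rw [Finset.card_product, Finset.card_product]
  push_cast
  have h0 : (0 : ℝ) ≤ (Mset M₀).card := Nat.cast_nonneg _
  calc ((Mset M₀).card : ℝ) * (((Mset M₀).card : ℝ) * ((Mset M₀).card : ℝ)) ≤ (3 * M₀) * ((3 * M₀) * (3 * M₀)) := by
        gcongr
    _ = (3 * (M₀ : ℝ)) ^ 3 := by ring

/-- The number of dyadic blocks: `(⌊log₂ M₀⌋ + 1)³ ≤ ((1 + 6/η) N^{2η})³` for `1 ≤ M₀ ≤ 3N²`. [folklore] -/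
theorem card_blocks_le {η : ℝ} (hη : 0 < η) (hη1 : η ≤ 1) {N : ℕ} (hN : (1 : ℝ) ≤ N) {M₀ : ℕ}
    (hM₀1 : 1 ≤ M₀) (hM₀ : (M₀ : ℝ) ≤ 3 * (N : ℝ) ^ 2) :
    ((Finset.range (Nat.log 2 M₀ + 1) ×ˢ
        (Finset.range (Nat.log 2 M₀ + 1) ×ˢ Finset.range (Nat.log 2 M₀ + 1))).card : ℝ) ≤
      ((1 + 6 / η) * ((N : ℝ) ^ η) ^ 2) ^ 3 := by
  set R := Finset.range (Nat.log 2 M₀ + 1) with hR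
  rw [Finset.card_product, Finset.card_product]
  push_cast
  have h1 : (R.card : ℝ) ≤ (1 + 6 / η) * ((N : ℝ) ^ η) ^ 2 := by
    rw [hR, Finset.card_range]
    exact card_range_log_le hη hη1 hN hM₀1 hM₀
  have h0 : (0 : ℝ) ≤ R.card := Nat.cast_nonneg _
  calc (R.card : ℝ) * ((R.card : ℝ) * (R.card : ℝ))
      ≤ ((1 + 6 / η) * ((N : ℝ) ^ η) ^ 2) * (((1 + 6 / η) * ((N : ℝ) ^ η) ^ 2) * ((1 + 6 / η) * ((N : ℝ) ^ η) ^ 2)) := by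
        gcongr
    _ = _ := by ring

set_option maxHeartbeats 1600000 in
/-- **Truncation cost** (Step 1 of the proof of Proposition 10.1): with `T = N^{6/5}`, `L = N^η`,
`(1+T)L ≤ NM₀ ≤ 3TL` and `ηj ≥ 12`, replacing `S₃` by `∑_{m ∈ 𝓜³} I_m` costs at most `A₄ T²|W|^{3/2}`
(`|B| ≪ (1+T)²/N²`, `|B − B♭| ≪ (1+T)^j N^{-j} M₀^{2-j} ≪ M₀² L^{-j}`, `|W| ≤ 2T`).
[cite: GuthMaynard2026, Section 7, (7.2)–(7.3) and proof of Proposition 10.1] -/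
theorem trunc_total {w : ℝ → ℝ} (hw : ContDiff ℝ ∞ w) (hsupp : Function.support w ⊆ Set.Icc 1 2)
    {η : ℝ} (hη0 : 0 < η) (hη12 : η ≤ 1 / 2) {j : ℕ} (hj2 : 2 ≤ j) (hηj : 12 ≤ η * j) :
    ∃ A₄, 0 ≤ A₄ ∧ ∀ (N : ℕ), (1 : ℝ) ≤ N → ∀ (t₀ : ℝ) (W : Finset ℝ),
      (∀ t ∈ W, t₀ ≤ t ∧ t ≤ t₀ + (N : ℝ) ^ (6 / 5 : ℝ)) →
      (W.card : ℝ) ≤ 2 * (N : ℝ) ^ (6 / 5 : ℝ) →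
      ∀ (M₀ : ℕ), 1 ≤ M₀ → (1 + (N : ℝ) ^ (6 / 5 : ℝ)) * (N : ℝ) ^ η ≤ (N : ℝ) * M₀ →
      (N : ℝ) * M₀ ≤ 3 * (N : ℝ) ^ (6 / 5 : ℝ) * (N : ℝ) ^ η →
      ‖S3 w N W - ∑ m ∈ Mset M₀ ×ˢ (Mset M₀ ×ˢ Mset M₀), Im w N W m‖ ≤
        A₄ * (((N : ℝ) ^ (6 / 5 : ℝ)) ^ 2 * (W.card : ℝ) ^ (3 / 2 : ℝ)) := by
  obtain ⟨C_γ, hC_γ0, hC_γ⟩ := norm_coefB_sub_coefBflat_le hw hsupp hj2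
  obtain ⟨C_β, hC_β0, hC_β⟩ := norm_coefB_le hw hsupp (le_refl 2)
  refine ⟨27 * C_γ * (4 * C_β + 9 * C_γ) ^ 2 * 4, by positivity, ?_⟩
  intro N hn1 t₀ W hW hKT M₀ hM₀1 hNM₀' hNM₀
  have hn0 : (0 : ℝ) < N := by linarith
  have hnle : ∀ {x y : ℝ}, x ≤ y → (N : ℝ) ^ x ≤ (N : ℝ) ^ y := fun h ↦ Real.rpow_le_rpow_of_exponent_le hn1 h
  have hnp : ∀ x y : ℝ, (N : ℝ) ^ x * (N : ℝ) ^ y = (N : ℝ) ^ (x + y) := fun x y ↦ (Real.rpow_add hn0 x y).symm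
  set A₄ : ℝ := 27 * C_γ * (4 * C_β + 9 * C_γ) ^ 2 * 4 with hA₄
  set T : ℝ := (N : ℝ) ^ (6 / 5 : ℝ) with hT
  have hT1 : 1 ≤ T := Real.one_le_rpow hn1 (by norm_num)
  have hT0 : 0 < T := by linarith
  set L : ℝ := (N : ℝ) ^ η with hL
  have hL1 : 1 ≤ L := Real.one_le_rpow hn1 hη0.le
  have hL0 : 0 < L := by linarith
  have hK0 : 0 ≤ (W.card : ℝ) := Nat.cast_nonneg _
  have hM₀r : (1 : ℝ) ≤ M₀ := by exact_mod_cast hM₀1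
  have hM₀0 : (0 : ℝ) < M₀ := by linarith
  -- the two uniform bounds `β, γ`
  set β : ℝ := C_β * (1 + T) ^ 2 with hβ
  set γ : ℝ := C_γ * (1 + T) ^ j / ((N : ℝ) ^ j * (M₀ : ℝ) ^ (j - 2)) with hγ
  have hβ0 : 0 ≤ β := by rw [hβ]; positivity
  have hγ0 : 0 ≤ γ := by rw [hγ]; positivity
  have hτ : ∀ t ∈ W, ∀ t' ∈ W, |t - t'| ≤ T := by
    intro t ht t' ht'
    have h1 := hW t ht
    have h2 := hW t' ht'
    rw [abs_le]; constructor <;> linarith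
  have hβW : ∀ t ∈ W, ∀ t' ∈ W, ‖coefB w N (t - t')‖ ≤ β := by
    intro t ht t' ht'
    refine (hC_β (t - t') N hn1).trans ?_
    rw [hβ, div_le_iff₀ (by positivity)]
    calc C_β * (1 + |t - t'|) ^ 2 ≤ C_β * (1 + T) ^ 2 := by gcongr; exact hτ t ht t' ht'
      _ = C_β * (1 + T) ^ 2 * 1 := (mul_one _).symm
      _ ≤ C_β * (1 + T) ^ 2 * (N : ℝ) ^ 2 := by gcongr; nlinarith
  have hγW : ∀ t ∈ W, ∀ t' ∈ W, ‖coefB w N (t - t') - coefBflat w N M₀ (t - t')‖ ≤ γ := by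
    intro t ht t' ht'
    refine (hC_γ (t - t') N hn1 M₀ hM₀1).trans ?_
    rw [hγ]
    gcongr
    exact hτ t ht t' ht'
  have htrunc := norm_S3_sub_sum_Im_le (w := w) N W M₀ hβ0 hγ0 hβW hγW
  -- `γ ≤ 9 C_γ T² L² N^{-2} L^{-j}`, `β + γ ≤ (4C_β + 9C_γ) T² L²`
  have hNM0 : 0 < (N : ℝ) * M₀ := by positivity
  have hq : (1 + T) / ((N : ℝ) * M₀) ≤ L⁻¹ := by
    rw [div_le_iff₀ hNM0, inv_mul_eq_div, le_div_iff₀ hL0]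
    linarith [hNM₀']
  have hγ1 : γ ≤ C_γ * (M₀ : ℝ) ^ 2 * (L ^ j)⁻¹ := by
    have hM₀j : (M₀ : ℝ) ^ j = (M₀ : ℝ) ^ (j - 2) * (M₀ : ℝ) ^ 2 := by rw [← pow_add, Nat.sub_add_cancel hj2]
    have e : (1 + T) ^ j / ((N : ℝ) ^ j * (M₀ : ℝ) ^ (j - 2)) = (M₀ : ℝ) ^ 2 * ((1 + T) / ((N : ℝ) * M₀)) ^ j := by
      rw [div_pow, mul_pow, hM₀j]
      field_simp
    rw [hγ, mul_div_assoc, e]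
    calc C_γ * ((M₀ : ℝ) ^ 2 * ((1 + T) / ((N : ℝ) * M₀)) ^ j) ≤ C_γ * ((M₀ : ℝ) ^ 2 * (L⁻¹) ^ j) := by gcongr
      _ = C_γ * (M₀ : ℝ) ^ 2 * (L ^ j)⁻¹ := by rw [inv_pow]; ring
  have hM₀sq : (M₀ : ℝ) ^ 2 * (N : ℝ) ^ 2 ≤ 9 * T ^ 2 * L ^ 2 := by
    have h := mul_le_mul hNM₀ hNM₀ (by positivity) (by positivity)
    calc (M₀ : ℝ) ^ 2 * (N : ℝ) ^ 2 = (N : ℝ) * M₀ * ((N : ℝ) * M₀) := by ring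
      _ ≤ 3 * T * L * (3 * T * L) := h
      _ = 9 * T ^ 2 * L ^ 2 := by ring
  have hLj : (L ^ j)⁻¹ = (N : ℝ) ^ (-(η * j)) := by
    rw [hL, ← Real.rpow_natCast, ← Real.rpow_mul hn0.le, Real.rpow_neg hn0.le]
  have hγ2 : γ ≤ 9 * C_γ * T ^ 2 * L ^ 2 / (N : ℝ) ^ 2 * (L ^ j)⁻¹ := by
    refine hγ1.trans ?_
    have : (M₀ : ℝ) ^ 2 ≤ 9 * T ^ 2 * L ^ 2 / (N : ℝ) ^ 2 := by rw [le_div_iff₀ (by positivity)]; exact hM₀sq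
    calc C_γ * (M₀ : ℝ) ^ 2 * (L ^ j)⁻¹ ≤ C_γ * (9 * T ^ 2 * L ^ 2 / (N : ℝ) ^ 2) * (L ^ j)⁻¹ := by gcongr
      _ = _ := by ring
  have hγ3 : γ ≤ 9 * C_γ * T ^ 2 * L ^ 2 := by
    refine hγ1.trans ?_
    have h1 : (L ^ j)⁻¹ ≤ 1 := inv_le_one_of_one_le₀ (one_le_pow₀ hL1)
    have h2 : (M₀ : ℝ) ^ 2 ≤ 9 * T ^ 2 * L ^ 2 := by
      have : (M₀ : ℝ) ^ 2 ≤ (M₀ : ℝ) ^ 2 * (N : ℝ) ^ 2 := le_mul_of_one_le_right (by positivity) (by nlinarith)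
      linarith
    calc C_γ * (M₀ : ℝ) ^ 2 * (L ^ j)⁻¹ ≤ C_γ * (9 * T ^ 2 * L ^ 2) * 1 := by gcongr
      _ = _ := by ring
  have hβ3 : β ≤ 4 * C_β * T ^ 2 * L ^ 2 := by
    have : (1 + T) ^ 2 ≤ 4 * T ^ 2 * L ^ 2 := by
      have h1 : (1 + T) ^ 2 ≤ 4 * T ^ 2 := by nlinarith
      have h2 : 4 * T ^ 2 ≤ 4 * T ^ 2 * L ^ 2 := le_mul_of_one_le_right (by positivity) (by nlinarith)
      linarith
    calc β = C_β * (1 + T) ^ 2 := rfl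
      _ ≤ C_β * (4 * T ^ 2 * L ^ 2) := by gcongr
      _ = _ := by ring
  have hβγ : β + γ ≤ (4 * C_β + 9 * C_γ) * T ^ 2 * L ^ 2 := by linarith
  have hK3 : (W.card : ℝ) ^ 3 ≤ 4 * T ^ 2 * (W.card : ℝ) ^ (3 / 2 : ℝ) := cube_le hK0 hT1 hKT
  have hpow1 : (N : ℝ) * T ^ 6 * L ^ 6 * (L ^ j)⁻¹ ≤ 1 := by
    rw [hLj]
    have eT : T ^ 6 = (N : ℝ) ^ (36 / 5 : ℝ) := by rw [hT, ← Real.rpow_natCast, ← Real.rpow_mul hn0.le]; norm_num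
    have eL : L ^ 6 = (N : ℝ) ^ (η * 6) := by rw [hL, ← Real.rpow_natCast, ← Real.rpow_mul hn0.le]; norm_num
    calc (N : ℝ) * T ^ 6 * L ^ 6 * (N : ℝ) ^ (-(η * j))
        = (N : ℝ) ^ (1 : ℝ) * (N : ℝ) ^ (36 / 5 : ℝ) * (N : ℝ) ^ (η * 6) * (N : ℝ) ^ (-(η * j)) := by
          rw [Real.rpow_one, eT, eL]
      _ = (N : ℝ) ^ (1 + 36 / 5 + η * 6 + -(η * j)) := by rw [hnp, hnp, hnp]
      _ ≤ (N : ℝ) ^ (0 : ℝ) := hnle (by nlinarith)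
      _ = 1 := Real.rpow_zero _
  have htrunc_le : (N : ℝ) ^ 3 * (W.card : ℝ) ^ 3 * (3 * γ * (β + γ) ^ 2) ≤
      A₄ * (T ^ 2 * (W.card : ℝ) ^ (3 / 2 : ℝ)) := by
    calc (N : ℝ) ^ 3 * (W.card : ℝ) ^ 3 * (3 * γ * (β + γ) ^ 2)
        ≤ (N : ℝ) ^ 3 * (4 * T ^ 2 * (W.card : ℝ) ^ (3 / 2 : ℝ)) *
            (3 * (9 * C_γ * T ^ 2 * L ^ 2 / (N : ℝ) ^ 2 * (L ^ j)⁻¹) * ((4 * C_β + 9 * C_γ) * T ^ 2 * L ^ 2) ^ 2) := by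
          gcongr
      _ = A₄ * (T ^ 2 * (W.card : ℝ) ^ (3 / 2 : ℝ)) * ((N : ℝ) * T ^ 6 * L ^ 6 * (L ^ j)⁻¹) := by
          simp only [hA₄]; field_simp; ring
      _ ≤ A₄ * (T ^ 2 * (W.card : ℝ) ^ (3 / 2 : ℝ)) * 1 := by gcongr
      _ = _ := mul_one _
  exact htrunc.trans htrunc_le

set_option maxHeartbeats 3200000 in
/-- **One dyadic block** (Step 2 of the proof of Proposition 10.1): for a block
`shell i₁ × shell i₂ × shell i₃` of `𝓜³` with `2^{i₁}, 2^{i₂} ≤ M₀`, either `i₃ ≥ max(i₁,i₂) + 5` and every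
`|I_m|` is negligible (`|θ| ≥ N` on the box), or the block is localised in the larger of `|m₁|, |m₂|`
(Proposition 7.2) and bounded through Proposition 9.1 for `f_B` (`main_block`):
`∑_{m ∈ block} |I_m| ≤ A₁ N^{4η} 𝒯 + |block| · C_n N³|W|³N^{-ηj}`, `𝒯 = T²|W|^{3/2} + TN|W|^{1/2}E(W)^{1/2}`.
[cite: GuthMaynard2026, proof of Proposition 10.1] -/
theorem block_bound {w : ℝ → ℝ} (hw : ContDiff ℝ ∞ w) (hsupp : Function.support w ⊆ Set.Icc 1 2)
    {η : ℝ} (hη0 : 0 < η) (hη12 : η ≤ 1 / 2) (j : ℕ) (hηj2 : 2 ≤ η * ((j : ℝ) - 1)) :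
    ∃ A₁ Cn N₀ : ℝ, 0 ≤ A₁ ∧ 0 ≤ Cn ∧ ∀ (N : ℕ), N₀ ≤ (N : ℝ) → ∀ (t₀ : ℝ) (W : Finset ℝ),
      (∀ t ∈ W, t₀ ≤ t ∧ t ≤ t₀ + (N : ℝ) ^ (6 / 5 : ℝ)) →
      (∀ t ∈ W, ∀ t' ∈ W, t ≠ t' → 1 ≤ |t - t'|) →
      ∀ (M₀ : ℕ), (N : ℝ) * M₀ ≤ 3 * (N : ℝ) ^ (6 / 5 : ℝ) * (N : ℝ) ^ η →
      ∀ (i₁ i₂ i₃ : ℕ), (2 : ℝ) ^ i₁ ≤ M₀ → (2 : ℝ) ^ i₂ ≤ M₀ →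
      ∑ m ∈ shell M₀ i₁ ×ˢ (shell M₀ i₂ ×ˢ shell M₀ i₃), ‖Im w N W m‖ ≤
        A₁ * ((N : ℝ) ^ η) ^ 4 * (((N : ℝ) ^ (6 / 5 : ℝ)) ^ 2 * (W.card : ℝ) ^ (3 / 2 : ℝ) +
          (N : ℝ) ^ (6 / 5 : ℝ) * N * (W.card : ℝ) ^ (1 / 2 : ℝ) * (addEnergy W) ^ (1 / 2 : ℝ)) +
        ((shell M₀ i₁ ×ˢ (shell M₀ i₂ ×ˢ shell M₀ i₃)).card : ℝ) *
          (Cn * ((N : ℝ) ^ 3 * (W.card : ℝ) ^ 3 * (N : ℝ) ^ (-(η * j)))) := by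
  have hη1 : η ≤ 1 := by linarith
  set P₁ : ℝ := ∫ x, psi1 x
  have hP₁0 : 0 < P₁ := integral_psi1_pos
  -- constants
  obtain ⟨C_b, hC_b0, hC_b⟩ := block_sum_le_snd hw hsupp hη0 j
  obtain ⟨C_b', -, hC_b'⟩ := block_sum_le_fst hw hsupp hη0 j
  obtain ⟨D, hD0, hD⟩ := norm_Im_le_majorant hw hsupp j
  obtain ⟨C₂, -, hC₂⟩ := integral_gW_le_card
  obtain ⟨C₄, -, hC₄⟩ := integral_gW_sq_le_energy j
  obtain ⟨C_F, -, hC_F⟩ := norm_fourier_fB_le_decay 4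
  obtain ⟨C₉, T₉, -, hC₉⟩ := affine_equidistribution hη0 hη1
  -- constants made `≥ 1`
  obtain ⟨C₂', hC₂'⟩ : ∃ C : ℝ, C = max C₂ 1 := ⟨_, rfl⟩
  obtain ⟨C₄', hC₄'⟩ : ∃ C : ℝ, C = max C₄ 1 := ⟨_, rfl⟩
  obtain ⟨C₉', hC₉'⟩ : ∃ C : ℝ, C = max C₉ 1 := ⟨_, rfl⟩
  have hC₂'1 : 1 ≤ C₂' := by rw [hC₂']; exact le_max_right _ _
  have hC₄'1 : 1 ≤ C₄' := by rw [hC₄']; exact le_max_right _ _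
  have hC₉'1 : 1 ≤ C₉' := by rw [hC₉']; exact le_max_right _ _
  have hC₂le : C₂ ≤ C₂' := by rw [hC₂']; exact le_max_left _ _
  have hC₄le : C₄ ≤ C₄' := by rw [hC₄']; exact le_max_left _ _
  have hC₉le : C₉ ≤ C₉' := by rw [hC₉']; exact le_max_left _ _
  obtain ⟨Cmb, hCmb⟩ : ∃ C : ℝ, C = max C_b C_b' := ⟨_, rfl⟩
  have hCb_le : C_b ≤ Cmb := by rw [hCmb]; exact le_max_left _ _
  have hCb'_le : C_b' ≤ Cmb := by rw [hCmb]; exact le_max_right _ _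
  have hCmb0 : 0 ≤ Cmb := hC_b0.trans hCb_le
  set A₁ : ℝ := 10 ^ 6 * Cmb * C₂' ^ 2 * C₉' * (max P₁ 1) * C₄' with hA₁
  have hA₁0 : 0 ≤ A₁ := by rw [hA₁]; positivity
  refine ⟨A₁, 9 / 4 * D + Cmb, max (max 2304 T₉) (max (C_F / P₁) 2), hA₁0, by positivity, ?_⟩
  intro N hN t₀ W hW hsep1 M₀ hNM₀ i₁ i₂ i₃ hi₁ hi₂
  -- thresholds
  have hN2304 : (2304 : ℝ) ≤ N := le_trans (le_trans (le_max_left _ _) (le_max_left _ _)) hN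
  have hNT₉ : T₉ ≤ N := le_trans (le_trans (le_max_right _ _) (le_max_left _ _)) hN
  have hNCF : C_F / P₁ ≤ N := le_trans (le_trans (le_max_left _ _) (le_max_right _ _)) hN
  have hNCF' : C_F ≤ P₁ * N := by rwa [div_le_iff₀' hP₁0] at hNCF
  have hn1 : (1 : ℝ) ≤ N := by linarith
  have hn0 : (0 : ℝ) < N := by linarith
  have hNnat : 1 ≤ N := by exact_mod_cast hn1
  have hKT : (W.card : ℝ) ≤ 2 * (N : ℝ) ^ (6 / 5 : ℝ) := GuthMaynardEnergyBound.card_le_two_mul hNnat hW hsep1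
  have hLN : (N : ℝ) ^ η ≤ N := by
    calc (N : ℝ) ^ η ≤ (N : ℝ) ^ (1 : ℝ) := Real.rpow_le_rpow_of_exponent_le hn1 hη1
      _ = N := Real.rpow_one _
  -- the constants' defining properties, with the enlarged constants
  have hC₂'' : ∫ u, gW W u ≤ C₂' * W.card :=
    (hC₂ W hsep1).trans (mul_le_mul_of_nonneg_right hC₂le (Nat.cast_nonneg _))
  have hC₄'' : ∀ (W' : Finset ℝ) (D' : ℝ), 1 ≤ D' →
      ∫ u, gW W' u ^ 2 ≤ C₄' * D' * addEnergy W' + C₄' * D' / D' ^ j * (W'.card : ℝ) ^ 4 := by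
    intro W' D' hD'
    have h0 : ∫ u, gW W' u ^ 2 ≤ C₄ * D' * addEnergy W' + C₄ * D' / D' ^ j * (W'.card : ℝ) ^ 4 := hC₄ W' D' hD'
    have hE' := addEnergy_nonneg W'
    have hD0 : 0 ≤ D' := by linarith
    have t1 : C₄ * D' * addEnergy W' ≤ C₄' * D' * addEnergy W' :=
      mul_le_mul_of_nonneg_right (mul_le_mul_of_nonneg_right hC₄le hD0) hE'
    have t2 : C₄ * D' / D' ^ j * (W'.card : ℝ) ^ 4 ≤ C₄' * D' / D' ^ j * (W'.card : ℝ) ^ 4 :=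
      mul_le_mul_of_nonneg_right (div_le_div_of_nonneg_right (mul_le_mul_of_nonneg_right hC₄le hD0) (by positivity))
        (by positivity)
    linarith
  have hNT₉' : max T₉ 0 ≤ (N : ℝ) := max_le hNT₉ hn0.le
  have hC₉'' : ∀ T' : ℝ, max T₉ 0 ≤ T' → ∀ M : ℝ, 1 ≤ M → M ≤ T' →
      ∀ f : ℝ → ℝ, ContDiff ℝ ∞ f → HasCompactSupport f → (∀ x, 0 ≤ f x) →
      (∀ x, f x ≠ 0 → 1 / 16 ≤ x ∧ x ≤ 9 / 2) →
      (∀ ζ : ℝ, ζ ≠ 0 → ‖𝓕 (fun y ↦ ((f y : ℝ) : ℂ)) ζ‖ ≤ T' ^ 2 * (∫ y, f y) * (T' / |ζ|) ^ 4) →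
      ∀ (I₁ I₂ : Finset ℤ) (M₁ M₂ : ℝ) (M₃ : ℕ), 1 ≤ M₁ → M₁ ≤ M → 1 ≤ M₂ → M₂ ≤ M → (M₃ : ℝ) ≤ 23 * M →
      (∀ m ∈ I₁, M₁ ≤ |(m : ℝ)| ∧ |(m : ℝ)| ≤ 2 * M₁) → (∀ m ∈ I₂, M₂ ≤ |(m : ℝ)| ∧ |(m : ℝ)| ≤ 2 * M₂) →
      Jfun f I₁ I₂ M₃ ≤ C₉' * T' ^ η * (M ^ 6 * (∫ y, f y) ^ 2 + M ^ 4 * ∫ y, f y ^ 2) := by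
    intro T' hT' M hM hMT f hfc hfs hf0 hfS hfd I₁ I₂ M₁ M₂ M₃ h1 h2 h3 h4 h5 h6 h7
    have hT'0 : 0 ≤ T' := le_trans (le_max_right _ _) hT'
    refine (hC₉ T' (le_trans (le_max_left _ _) hT') M hM hMT f hfc hfs hf0 hfS hfd I₁ I₂ M₁ M₂ M₃
      h1 h2 h3 h4 h5 h6 h7).trans ?_
    have : 0 ≤ ∫ y, f y ^ 2 := integral_nonneg fun y ↦ sq_nonneg _
    exact mul_le_mul_of_nonneg_right (mul_le_mul_of_nonneg_right hC₉le (by positivity)) (by positivity)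
  clear hC₉ hC₄ hC₂
  -- the two block estimates, specialised
  have hblk₂ := hC_b N hNnat W M₀ i₁ i₂ i₃
  have hblk₁ := hC_b' N hNnat W M₀ i₁ i₂ i₃
  clear hC_b hC_b'
  -- abbreviations
  have hK0 : 0 ≤ (W.card : ℝ) := Nat.cast_nonneg _
  have hE0 : 0 ≤ addEnergy W := addEnergy_nonneg W
  set 𝒯 : ℝ := ((N : ℝ) ^ (6 / 5 : ℝ)) ^ 2 * (W.card : ℝ) ^ (3 / 2 : ℝ) +
    (N : ℝ) ^ (6 / 5 : ℝ) * N * (W.card : ℝ) ^ (1 / 2 : ℝ) * (addEnergy W) ^ (1 / 2 : ℝ) with h𝒯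
  have h𝒯0 : 0 ≤ 𝒯 := by rw [h𝒯]; positivity
  set negl : ℝ := (9 / 4 * D + Cmb) * ((N : ℝ) ^ 3 * (W.card : ℝ) ^ 3 * (N : ℝ) ^ (-(η * j))) with hnegl
  have hnegl0 : 0 ≤ negl := by rw [hnegl]; positivity
  have hALT : 0 ≤ A₁ * ((N : ℝ) ^ η) ^ 4 * 𝒯 := by positivity
  set S := shell M₀ i₁ ×ˢ (shell M₀ i₂ ×ˢ shell M₀ i₃)
  by_cases hfar : max i₁ i₂ + 5 ≤ i₃
  · -- negligible block
    have hterm : ∀ m ∈ S, ‖Im w N W m‖ ≤ negl := by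
      intro m hm
      refine (hD N W m).trans ((majorant_le_of_far_block hD0 j N W hfar hm).trans ?_)
      have h1 : D / (1 + (N : ℝ)) ^ j ≤ D * (N : ℝ) ^ (-(η * j)) := by
        rw [div_eq_mul_inv]
        refine mul_le_mul_of_nonneg_left ?_ hD0
        rw [Real.rpow_neg hn0.le]
        refine inv_anti₀ (by positivity) ?_
        calc (N : ℝ) ^ (η * j) = ((N : ℝ) ^ η) ^ j := by rw [Real.rpow_mul hn0.le, Real.rpow_natCast]
          _ ≤ (1 + (N : ℝ)) ^ j := pow_le_pow_left₀ (by positivity) (by linarith [hLN]) j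
      calc (N : ℝ) ^ 3 * (9 / 4 * (W.card : ℝ) ^ 3 * (D / (1 + (N : ℝ)) ^ j))
          ≤ (N : ℝ) ^ 3 * (9 / 4 * (W.card : ℝ) ^ 3 * (D * (N : ℝ) ^ (-(η * j)))) := by gcongr
        _ = (9 / 4 * D) * ((N : ℝ) ^ 3 * (W.card : ℝ) ^ 3 * (N : ℝ) ^ (-(η * j))) := by ring
        _ ≤ (9 / 4 * D + Cmb) * ((N : ℝ) ^ 3 * (W.card : ℝ) ^ 3 * (N : ℝ) ^ (-(η * j))) := by
            gcongr; linarith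
    calc ∑ m ∈ S, ‖Im w N W m‖ ≤ ∑ m ∈ S, negl := Finset.sum_le_sum hterm
      _ = (S.card : ℝ) * negl := by rw [Finset.sum_const, nsmul_eq_mul]
      _ ≤ A₁ * ((N : ℝ) ^ η) ^ 4 * 𝒯 + (S.card : ℝ) * negl := by linarith
  · rw [not_le] at hfar
    rcases le_or_gt i₁ i₂ with h12 | h12
    · -- localise in `v₂`: `|m₂| ≥ 2^{i₂}`
      have hmain := main_block (C_b := Cmb) (ia := i₁) (ib := i₂) (i₃ := i₃) hη0 hη12 hC₉'1 hC₉'' hC_F hC₂'1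
        hC₄'1 hηj2 hC₄'' hCmb0 hN2304 hNT₉' hNCF' W hC₂'' hKT hNM₀ h12 (by omega) hi₂
      have hX0 : 0 ≤ (∫ u, gW W u) ^ (1 / 2 : ℝ) *
          (4 * Jfun (fB W ((N : ℝ) * 2 ^ i₂ / (N : ℝ) ^ η)) (shell M₀ i₃) (shell M₀ i₂) (2 ^ (i₁ + 1))) ^ (1 / 4 : ℝ) *
          (Jfun (fB W ((N : ℝ) * 2 ^ i₂ / (N : ℝ) ^ η)) (shell M₀ i₁) (shell M₀ i₂) (2 ^ (i₃ + 1))) ^ (1 / 4 : ℝ) :=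
        mul_nonneg (mul_nonneg (Real.rpow_nonneg (integral_nonneg (gW_nonneg W)) _)
          (Real.rpow_nonneg (mul_nonneg (by norm_num) (integral_nonneg fun u ↦ sq_nonneg _)) _))
          (Real.rpow_nonneg (integral_nonneg fun u ↦ sq_nonneg _) _)
      have hQ0 : 0 ≤ (N : ℝ) ^ 3 / ((N : ℝ) * 2 ^ i₂ / (N : ℝ) ^ η) := by positivity
      set X : ℝ := (∫ u, gW W u) ^ (1 / 2 : ℝ) *
          (4 * Jfun (fB W ((N : ℝ) * 2 ^ i₂ / (N : ℝ) ^ η)) (shell M₀ i₃) (shell M₀ i₂) (2 ^ (i₁ + 1))) ^ (1 / 4 : ℝ) *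
          (Jfun (fB W ((N : ℝ) * 2 ^ i₂ / (N : ℝ) ^ η)) (shell M₀ i₁) (shell M₀ i₂) (2 ^ (i₃ + 1))) ^ (1 / 4 : ℝ)
      set Q : ℝ := (N : ℝ) ^ 3 / ((N : ℝ) * 2 ^ i₂ / (N : ℝ) ^ η)
      have hmain' : Cmb * Q * X ≤ A₁ * ((N : ℝ) ^ η) ^ 4 * 𝒯 := hmain
      have hblk' : ∑ m ∈ S, ‖Im w N W m‖ ≤ C_b * Q * X +
          C_b * (S.card : ℝ) * ((N : ℝ) ^ 3 * (W.card : ℝ) ^ 3 * (N : ℝ) ^ (-(η * j))) := hblk₂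
      have hCb1 : C_b * Q * X ≤ Cmb * Q * X :=
        mul_le_mul_of_nonneg_right (mul_le_mul_of_nonneg_right hCb_le hQ0) hX0
      have hCb2 : C_b * (S.card : ℝ) * ((N : ℝ) ^ 3 * (W.card : ℝ) ^ 3 * (N : ℝ) ^ (-(η * j))) ≤
          (S.card : ℝ) * negl := by
        have h1 : C_b ≤ 9 / 4 * D + Cmb := by linarith
        calc C_b * (S.card : ℝ) * ((N : ℝ) ^ 3 * (W.card : ℝ) ^ 3 * (N : ℝ) ^ (-(η * j)))
            = (S.card : ℝ) * (C_b * ((N : ℝ) ^ 3 * (W.card : ℝ) ^ 3 * (N : ℝ) ^ (-(η * j)))) := by ring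
          _ ≤ (S.card : ℝ) * ((9 / 4 * D + Cmb) * ((N : ℝ) ^ 3 * (W.card : ℝ) ^ 3 * (N : ℝ) ^ (-(η * j)))) :=
              mul_le_mul_of_nonneg_left (mul_le_mul_of_nonneg_right h1 (by positivity)) (Nat.cast_nonneg _)
      linarith only [hblk', hmain', hCb1, hCb2]
    · -- localise in `v₁`: `|m₁| ≥ 2^{i₁}`
      have hmain := main_block (C_b := Cmb) (ia := i₂) (ib := i₁) (i₃ := i₃) hη0 hη12 hC₉'1 hC₉'' hC_F hC₂'1
        hC₄'1 hηj2 hC₄'' hCmb0 hN2304 hNT₉' hNCF' W hC₂'' hKT hNM₀ h12.le (by omega) hi₁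
      have hX0 : 0 ≤ (∫ u, gW W u) ^ (1 / 2 : ℝ) *
          (4 * Jfun (fB W ((N : ℝ) * 2 ^ i₁ / (N : ℝ) ^ η)) (shell M₀ i₃) (shell M₀ i₁) (2 ^ (i₂ + 1))) ^ (1 / 4 : ℝ) *
          (Jfun (fB W ((N : ℝ) * 2 ^ i₁ / (N : ℝ) ^ η)) (shell M₀ i₂) (shell M₀ i₁) (2 ^ (i₃ + 1))) ^ (1 / 4 : ℝ) :=
        mul_nonneg (mul_nonneg (Real.rpow_nonneg (integral_nonneg (gW_nonneg W)) _)
          (Real.rpow_nonneg (mul_nonneg (by norm_num) (integral_nonneg fun u ↦ sq_nonneg _)) _))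
          (Real.rpow_nonneg (integral_nonneg fun u ↦ sq_nonneg _) _)
      have hQ0 : 0 ≤ (N : ℝ) ^ 3 / ((N : ℝ) * 2 ^ i₁ / (N : ℝ) ^ η) := by positivity
      set X : ℝ := (∫ u, gW W u) ^ (1 / 2 : ℝ) *
          (4 * Jfun (fB W ((N : ℝ) * 2 ^ i₁ / (N : ℝ) ^ η)) (shell M₀ i₃) (shell M₀ i₁) (2 ^ (i₂ + 1))) ^ (1 / 4 : ℝ) *
          (Jfun (fB W ((N : ℝ) * 2 ^ i₁ / (N : ℝ) ^ η)) (shell M₀ i₂) (shell M₀ i₁) (2 ^ (i₃ + 1))) ^ (1 / 4 : ℝ)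
      set Q : ℝ := (N : ℝ) ^ 3 / ((N : ℝ) * 2 ^ i₁ / (N : ℝ) ^ η)
      have hmain' : Cmb * Q * X ≤ A₁ * ((N : ℝ) ^ η) ^ 4 * 𝒯 := hmain
      have hblk' : ∑ m ∈ S, ‖Im w N W m‖ ≤ C_b' * Q * X +
          C_b' * (S.card : ℝ) * ((N : ℝ) ^ 3 * (W.card : ℝ) ^ 3 * (N : ℝ) ^ (-(η * j))) := hblk₁
      have hCb1 : C_b' * Q * X ≤ Cmb * Q * X :=
        mul_le_mul_of_nonneg_right (mul_le_mul_of_nonneg_right hCb'_le hQ0) hX0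
      have hCb2 : C_b' * (S.card : ℝ) * ((N : ℝ) ^ 3 * (W.card : ℝ) ^ 3 * (N : ℝ) ^ (-(η * j))) ≤
          (S.card : ℝ) * negl := by
        have h1 : C_b' ≤ 9 / 4 * D + Cmb := by linarith
        calc C_b' * (S.card : ℝ) * ((N : ℝ) ^ 3 * (W.card : ℝ) ^ 3 * (N : ℝ) ^ (-(η * j)))
            = (S.card : ℝ) * (C_b' * ((N : ℝ) ^ 3 * (W.card : ℝ) ^ 3 * (N : ℝ) ^ (-(η * j)))) := by ring
          _ ≤ (S.card : ℝ) * ((9 / 4 * D + Cmb) * ((N : ℝ) ^ 3 * (W.card : ℝ) ^ 3 * (N : ℝ) ^ (-(η * j)))) :=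
              mul_le_mul_of_nonneg_left (mul_le_mul_of_nonneg_right h1 (by positivity)) (Nat.cast_nonneg _)
      linarith only [hblk', hmain', hCb1, hCb2]

set_option maxHeartbeats 1600000 in
/-- **Guth–Maynard Proposition 10.1 (refined `S₃` bound)**, in the exact form of the hypothesis `hS3` of
`GuthMaynardEnergyBound.zeroDensity_guth_maynard_of_S3`: for every admissible cutoff `w` and every
`ε, δ > 0` there are `C, N₀` with
`|S₃| ≤ C N^δ (T²|W|^{3/2} + TN|W|^{1/2}E(W)^{1/2})` for `N ≥ N₀`, `T = N^{6/5}`, `W ⊂ [t₀, t₀+T]`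
`T^ε`-separated. Proof: `η = min(1/2, δ/10)`, `j = ⌈12/η⌉ + 1`, `M₀ = ⌈(1+T)N^{η−1}⌉`; truncation
(`trunc_total`), the `O(N^{6η})` dyadic blocks (`block_bound`), and `|𝓜³| N³|W|³N^{-ηj} ≪ T²|W|^{3/2}`.
[cite: GuthMaynard2026, Proposition 10.1] -/
theorem S3_bound (w : ℝ → ℝ) (hw : ContDiff ℝ ∞ w) (hsupp : Function.support w ⊆ Set.Icc 1 2)
    (_hw1 : ∀ u : ℝ, 6 / 5 ≤ u → u ≤ 9 / 5 → w u = 1) (_hw01 : ∀ u, 0 ≤ w u ∧ w u ≤ 1)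
    (ε : ℝ) (hε : 0 < ε) (δ : ℝ) (hδ : 0 < δ) :
    ∃ C N₀ : ℝ, ∀ N : ℕ, N₀ ≤ (N : ℝ) → ∀ (t₀ : ℝ) (W : Finset ℝ),
      (∀ t ∈ W, t₀ ≤ t ∧ t ≤ t₀ + (N : ℝ) ^ (6 / 5 : ℝ)) →
      (∀ t ∈ W, ∀ t' ∈ W, t ≠ t' → ((N : ℝ) ^ (6 / 5 : ℝ)) ^ ε ≤ |t - t'|) →
      ‖S3 w N W‖ ≤ C * (N : ℝ) ^ δ * (((N : ℝ) ^ (6 / 5 : ℝ)) ^ 2 * (W.card : ℝ) ^ (3 / 2 : ℝ) +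
        (N : ℝ) ^ (6 / 5 : ℝ) * N * (W.card : ℝ) ^ (1 / 2 : ℝ) * (addEnergy W) ^ (1 / 2 : ℝ)) := by
  -- exponents
  obtain ⟨η, hη⟩ : ∃ η : ℝ, η = min (1 / 2) (δ / 10) := ⟨_, rfl⟩
  have hη0 : 0 < η := by rw [hη]; exact lt_min (by norm_num) (by positivity)
  have hη12 : η ≤ 1 / 2 := by rw [hη]; exact min_le_left _ _
  have hη1 : η ≤ 1 := by linarith
  have hηδ : 10 * η ≤ δ := by have := min_le_right (1 / 2 : ℝ) (δ / 10); rw [← hη] at this; linarith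
  obtain ⟨j, hj⟩ : ∃ j : ℕ, j = ⌈12 / η⌉₊ + 1 := ⟨_, rfl⟩
  have hj2 : 2 ≤ j := by
    have : 1 ≤ ⌈12 / η⌉₊ := Nat.one_le_iff_ne_zero.mpr (Nat.ceil_pos.mpr (by positivity)).ne'
    omega
  have hηj1 : 12 ≤ η * ((j : ℝ) - 1) := by
    have h1 : ((j : ℝ) - 1) = (⌈12 / η⌉₊ : ℝ) := by rw [hj]; push_cast; ring
    have h2 : 12 / η ≤ (⌈12 / η⌉₊ : ℝ) := Nat.le_ceil _
    rw [h1]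
    calc (12 : ℝ) = η * (12 / η) := by field_simp
      _ ≤ η * (⌈12 / η⌉₊ : ℝ) := by gcongr
  have hj1 : (1 : ℝ) ≤ j := by exact_mod_cast (by omega : 1 ≤ j)
  have hηj : 12 ≤ η * j := by nlinarith
  have hηj2 : 2 ≤ η * ((j : ℝ) - 1) := by linarith
  -- constants
  obtain ⟨A₄, hA₄0, hA₄⟩ := trunc_total hw hsupp hη0 hη12 hj2 hηj
  obtain ⟨A₁, Cn, N₁, hA₁0, hCn0, hblock⟩ := block_bound hw hsupp hη0 hη12 j hηj2
  set A₂ : ℝ := (1 + 6 / η) ^ 3 * A₁ with hA₂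
  set A₃ : ℝ := 27 * 27 * Cn * 4 with hA₃
  have hA₂0 : 0 ≤ A₂ := by rw [hA₂]; positivity
  have hA₃0 : 0 ≤ A₃ := by rw [hA₃]; positivity
  refine ⟨A₂ + A₃ + A₄, max N₁ 1, ?_⟩
  intro N hN t₀ W hW hsep
  -- thresholds and basic quantities
  have hNN₁ : N₁ ≤ N := le_trans (le_max_left _ _) hN
  have hn1 : (1 : ℝ) ≤ N := le_trans (le_max_right _ _) hN
  have hn0 : (0 : ℝ) < N := by linarith
  have hNnat : 1 ≤ N := by exact_mod_cast hn1
  have hnle : ∀ {x y : ℝ}, x ≤ y → (N : ℝ) ^ x ≤ (N : ℝ) ^ y := fun h ↦ Real.rpow_le_rpow_of_exponent_le hn1 h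
  have hnp : ∀ x y : ℝ, (N : ℝ) ^ x * (N : ℝ) ^ y = (N : ℝ) ^ (x + y) := fun x y ↦ (Real.rpow_add hn0 x y).symm
  have hn1le : ∀ {x : ℝ}, 0 ≤ x → 1 ≤ (N : ℝ) ^ x := fun h ↦ Real.one_le_rpow hn1 h
  set T : ℝ := (N : ℝ) ^ (6 / 5 : ℝ) with hT
  have hT1 : 1 ≤ T := hn1le (by norm_num)
  have hT0 : 0 < T := by linarith
  have hNT : (N : ℝ) ≤ T := by
    calc (N : ℝ) = (N : ℝ) ^ (1 : ℝ) := (Real.rpow_one _).symm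
      _ ≤ T := hnle (by norm_num)
  have hK0 : 0 ≤ (W.card : ℝ) := Nat.cast_nonneg _
  have hE0 : 0 ≤ addEnergy W := addEnergy_nonneg W
  have hsep1 : ∀ t ∈ W, ∀ t' ∈ W, t ≠ t' → 1 ≤ |t - t'| := by
    intro t ht t' ht' hne
    have h1 := hsep t ht t' ht' hne
    have h2 : 1 ≤ T ^ ε := Real.one_le_rpow hT1 hε.le
    linarith
  have hKT : (W.card : ℝ) ≤ 2 * T := GuthMaynardEnergyBound.card_le_two_mul hNnat hW hsep1
  set L : ℝ := (N : ℝ) ^ η with hL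
  have hL1 : 1 ≤ L := hn1le hη0.le
  have hL0 : 0 < L := by linarith
  -- `M₀`
  set M₀ : ℕ := ⌈(1 + T) * (N : ℝ) ^ (η - 1)⌉₊
  have hM₀pos : 0 < (1 + T) * (N : ℝ) ^ (η - 1) := by positivity
  have hM₀1 : 1 ≤ M₀ := Nat.one_le_iff_ne_zero.mpr (Nat.ceil_pos.mpr hM₀pos).ne'
  have hM₀r : (1 : ℝ) ≤ M₀ := by exact_mod_cast hM₀1
  have hM₀lo : (1 + T) * (N : ℝ) ^ (η - 1) ≤ M₀ := Nat.le_ceil _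
  have hM₀hi : (M₀ : ℝ) ≤ (1 + T) * (N : ℝ) ^ (η - 1) + 1 := (Nat.ceil_lt_add_one hM₀pos.le).le
  have hNη1 : (N : ℝ) * (N : ℝ) ^ (η - 1) = L := by
    rw [hL, show (N : ℝ) * (N : ℝ) ^ (η - 1) = (N : ℝ) ^ (1 : ℝ) * (N : ℝ) ^ (η - 1) by rw [Real.rpow_one], hnp]
    ring_nf
  have hNM₀ : (N : ℝ) * M₀ ≤ 3 * T * L := by
    calc (N : ℝ) * M₀ ≤ (N : ℝ) * ((1 + T) * (N : ℝ) ^ (η - 1) + 1) := by gcongr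
      _ = (1 + T) * ((N : ℝ) * (N : ℝ) ^ (η - 1)) + N := by ring
      _ = (1 + T) * L + N := by rw [hNη1]
      _ ≤ (T + T) * L + T * L := by
          gcongr
          calc (N : ℝ) = N * 1 := (mul_one _).symm
            _ ≤ T * L := by gcongr
      _ = 3 * T * L := by ring
  have hNM₀' : (1 + T) * L ≤ (N : ℝ) * M₀ := by
    calc (1 + T) * L = (N : ℝ) * ((1 + T) * (N : ℝ) ^ (η - 1)) := by rw [← hNη1]; ring
      _ ≤ (N : ℝ) * M₀ := by gcongr
  have hM₀T : (M₀ : ℝ) ≤ 3 * (N : ℝ) ^ 2 := by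
    have h1 : (M₀ : ℝ) ≤ (N : ℝ) * M₀ := le_mul_of_one_le_left (by positivity) hn1
    have h2 : T * L ≤ (N : ℝ) ^ 2 := by
      rw [hT, hL, hnp, show ((N : ℝ)) ^ 2 = (N : ℝ) ^ (2 : ℝ) by norm_cast]
      exact hnle (by linarith)
    linarith
  -- Step 1: truncation
  have htrunc : ‖S3 w N W - ∑ m ∈ Mset M₀ ×ˢ (Mset M₀ ×ˢ Mset M₀), Im w N W m‖ ≤
      A₄ * (T ^ 2 * (W.card : ℝ) ^ (3 / 2 : ℝ)) := hA₄ N hn1 t₀ W hW hKT M₀ hM₀1 hNM₀' hNM₀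
  -- Step 2: the blocks
  set R := Finset.range (Nat.log 2 M₀ + 1) with hR
  set 𝒯 : ℝ := T ^ 2 * (W.card : ℝ) ^ (3 / 2 : ℝ) +
    T * N * (W.card : ℝ) ^ (1 / 2 : ℝ) * (addEnergy W) ^ (1 / 2 : ℝ) with h𝒯
  have h𝒯0 : 0 ≤ 𝒯 := by rw [h𝒯]; positivity
  set negl : ℝ := Cn * ((N : ℝ) ^ 3 * (W.card : ℝ) ^ 3 * (N : ℝ) ^ (-(η * j))) with hnegl
  have hnegl0 : 0 ≤ negl := by rw [hnegl]; positivity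
  have hpow2 : ∀ {i : ℕ}, i ∈ R → (2 : ℝ) ^ i ≤ M₀ := by
    intro i hi
    rw [hR, Finset.mem_range, Nat.lt_succ_iff] at hi
    have : 2 ^ i ≤ M₀ := (Nat.pow_le_pow_right (by norm_num) hi).trans (Nat.pow_log_le_self 2 (by omega))
    exact_mod_cast this
  have hblock' : ∀ b ∈ R ×ˢ (R ×ˢ R),
      ∑ m ∈ shell M₀ b.1 ×ˢ (shell M₀ b.2.1 ×ˢ shell M₀ b.2.2), ‖Im w N W m‖ ≤ A₁ * L ^ 4 * 𝒯 +
        ((shell M₀ b.1 ×ˢ (shell M₀ b.2.1 ×ˢ shell M₀ b.2.2)).card : ℝ) * negl := by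
    rintro ⟨i₁, i₂, i₃⟩ hb
    simp only [Finset.mem_product] at hb
    obtain ⟨hi₁, hi₂, -⟩ := hb
    exact hblock N hNN₁ t₀ W hW hsep1 M₀ hNM₀ i₁ i₂ i₃ (hpow2 hi₁) (hpow2 hi₂)
  -- sum over the blocks
  have hsum := sum_Mset3_eq_sum_blocks M₀ (fun m ↦ ‖Im w N W m‖)
  have hcard_blocks : ∑ b ∈ R ×ˢ (R ×ˢ R), ((shell M₀ b.1 ×ˢ (shell M₀ b.2.1 ×ˢ shell M₀ b.2.2)).card : ℝ) =
      ((Mset M₀ ×ˢ (Mset M₀ ×ˢ Mset M₀)).card : ℝ) := by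
    have h := sum_Mset3_eq_sum_blocks M₀ (fun _ ↦ (1 : ℝ))
    simp only [Finset.sum_const, nsmul_eq_mul, mul_one] at h
    rw [hR]; exact h.symm
  have hMset_card : ((Mset M₀ ×ˢ (Mset M₀ ×ˢ Mset M₀)).card : ℝ) ≤ (3 * (M₀ : ℝ)) ^ 3 := card_Mset3_le hM₀1
  have hRcard : ((R ×ˢ (R ×ˢ R)).card : ℝ) ≤ ((1 + 6 / η) * L ^ 2) ^ 3 := card_blocks_le hη0 hη1 hn1 hM₀1 hM₀T
  have hALT : 0 ≤ A₁ * L ^ 4 * 𝒯 := by positivity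
  have hblocks_total : ∑ m ∈ Mset M₀ ×ˢ (Mset M₀ ×ˢ Mset M₀), ‖Im w N W m‖ ≤
      ((1 + 6 / η) * L ^ 2) ^ 3 * (A₁ * L ^ 4 * 𝒯) + (3 * (M₀ : ℝ)) ^ 3 * negl := by
    rw [hsum, ← hR]
    calc ∑ b ∈ R ×ˢ (R ×ˢ R), ∑ m ∈ shell M₀ b.1 ×ˢ (shell M₀ b.2.1 ×ˢ shell M₀ b.2.2), ‖Im w N W m‖
        ≤ ∑ b ∈ R ×ˢ (R ×ˢ R), (A₁ * L ^ 4 * 𝒯 +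
            ((shell M₀ b.1 ×ˢ (shell M₀ b.2.1 ×ˢ shell M₀ b.2.2)).card : ℝ) * negl) := Finset.sum_le_sum hblock'
      _ = ((R ×ˢ (R ×ˢ R)).card : ℝ) * (A₁ * L ^ 4 * 𝒯) +
            (∑ b ∈ R ×ˢ (R ×ˢ R), ((shell M₀ b.1 ×ˢ (shell M₀ b.2.1 ×ˢ shell M₀ b.2.2)).card : ℝ)) * negl := by
          rw [Finset.sum_add_distrib, Finset.sum_const, nsmul_eq_mul, ← Finset.sum_mul]
      _ ≤ ((1 + 6 / η) * L ^ 2) ^ 3 * (A₁ * L ^ 4 * 𝒯) + (3 * (M₀ : ℝ)) ^ 3 * negl := by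
          rw [hcard_blocks]
          gcongr
  -- the negligible total is `≤ A₃ T² |W|^{3/2}`
  have hK3 : (W.card : ℝ) ^ 3 ≤ 4 * T ^ 2 * (W.card : ℝ) ^ (3 / 2 : ℝ) := cube_le hK0 hT1 hKT
  have hpow3 : T ^ 3 * L ^ 3 * (N : ℝ) ^ (-(η * j)) ≤ 1 := by
    have eT : T ^ 3 = (N : ℝ) ^ (18 / 5 : ℝ) := by rw [hT, ← Real.rpow_natCast, ← Real.rpow_mul hn0.le]; norm_num
    have eL : L ^ 3 = (N : ℝ) ^ (η * 3) := by rw [hL, ← Real.rpow_natCast, ← Real.rpow_mul hn0.le]; norm_num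
    rw [eT, eL, hnp, hnp]
    calc (N : ℝ) ^ (18 / 5 + η * 3 + -(η * j)) ≤ (N : ℝ) ^ (0 : ℝ) := hnle (by nlinarith)
      _ = 1 := Real.rpow_zero _
  have hnegl_total : (3 * (M₀ : ℝ)) ^ 3 * negl ≤ A₃ * (T ^ 2 * (W.card : ℝ) ^ (3 / 2 : ℝ)) := by
    have hM₀3 : (3 * (M₀ : ℝ)) ^ 3 * (N : ℝ) ^ 3 ≤ 27 * (3 * T * L) ^ 3 := by
      calc (3 * (M₀ : ℝ)) ^ 3 * (N : ℝ) ^ 3 = 27 * ((N : ℝ) * M₀) ^ 3 := by ring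
        _ ≤ 27 * (3 * T * L) ^ 3 := by gcongr
    calc (3 * (M₀ : ℝ)) ^ 3 * negl
        = Cn * ((3 * (M₀ : ℝ)) ^ 3 * (N : ℝ) ^ 3) * (W.card : ℝ) ^ 3 * (N : ℝ) ^ (-(η * j)) := by
          simp only [hnegl]; ring
      _ ≤ Cn * (27 * (3 * T * L) ^ 3) * (4 * T ^ 2 * (W.card : ℝ) ^ (3 / 2 : ℝ)) * (N : ℝ) ^ (-(η * j)) := by
          gcongr
      _ = A₃ * (T ^ 2 * (W.card : ℝ) ^ (3 / 2 : ℝ)) * (T ^ 3 * L ^ 3 * (N : ℝ) ^ (-(η * j))) := by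
          simp only [hA₃]; ring
      _ ≤ A₃ * (T ^ 2 * (W.card : ℝ) ^ (3 / 2 : ℝ)) * 1 := by gcongr
      _ = _ := mul_one _
  -- the main total is `≤ A₂ N^δ 𝒯`
  have hLδ : L ^ 10 ≤ (N : ℝ) ^ δ := by
    rw [hL, ← Real.rpow_natCast, ← Real.rpow_mul hn0.le]
    exact hnle (by push_cast; nlinarith)
  have hNδ1 : 1 ≤ (N : ℝ) ^ δ := hn1le hδ.le
  have hmain_total : ((1 + 6 / η) * L ^ 2) ^ 3 * (A₁ * L ^ 4 * 𝒯) ≤ A₂ * (N : ℝ) ^ δ * 𝒯 := by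
    calc ((1 + 6 / η) * L ^ 2) ^ 3 * (A₁ * L ^ 4 * 𝒯) = A₂ * L ^ 10 * 𝒯 := by simp only [hA₂]; ring
      _ ≤ A₂ * (N : ℝ) ^ δ * 𝒯 := by gcongr
  have h𝒯1 : T ^ 2 * (W.card : ℝ) ^ (3 / 2 : ℝ) ≤ (N : ℝ) ^ δ * 𝒯 := by
    have h1 : T ^ 2 * (W.card : ℝ) ^ (3 / 2 : ℝ) ≤ 𝒯 := by
      simp only [h𝒯]
      have : 0 ≤ T * N * (W.card : ℝ) ^ (1 / 2 : ℝ) * (addEnergy W) ^ (1 / 2 : ℝ) := by positivity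
      linarith
    calc T ^ 2 * (W.card : ℝ) ^ (3 / 2 : ℝ) ≤ 𝒯 := h1
      _ = 1 * 𝒯 := (one_mul _).symm
      _ ≤ (N : ℝ) ^ δ * 𝒯 := by gcongr
  -- assemble
  have hsplit : ‖S3 w N W‖ ≤ ‖S3 w N W - ∑ m ∈ Mset M₀ ×ˢ (Mset M₀ ×ˢ Mset M₀), Im w N W m‖ +
      ∑ m ∈ Mset M₀ ×ˢ (Mset M₀ ×ˢ Mset M₀), ‖Im w N W m‖ := by
    calc ‖S3 w N W‖ = ‖(S3 w N W - ∑ m ∈ Mset M₀ ×ˢ (Mset M₀ ×ˢ Mset M₀), Im w N W m) +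
          ∑ m ∈ Mset M₀ ×ˢ (Mset M₀ ×ˢ Mset M₀), Im w N W m‖ := by rw [sub_add_cancel]
      _ ≤ ‖S3 w N W - ∑ m ∈ Mset M₀ ×ˢ (Mset M₀ ×ˢ Mset M₀), Im w N W m‖ +
          ‖∑ m ∈ Mset M₀ ×ˢ (Mset M₀ ×ˢ Mset M₀), Im w N W m‖ := norm_add_le _ _
      _ ≤ _ := by gcongr; exact norm_sum_le _ _
  have hfin : ‖S3 w N W‖ ≤ A₄ * (T ^ 2 * (W.card : ℝ) ^ (3 / 2 : ℝ)) +
      (A₂ * (N : ℝ) ^ δ * 𝒯 + A₃ * (T ^ 2 * (W.card : ℝ) ^ (3 / 2 : ℝ))) := by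
    linarith [hsplit, htrunc, hblocks_total, hnegl_total, hmain_total]
  calc ‖S3 w N W‖ ≤ A₄ * (T ^ 2 * (W.card : ℝ) ^ (3 / 2 : ℝ)) +
        (A₂ * (N : ℝ) ^ δ * 𝒯 + A₃ * (T ^ 2 * (W.card : ℝ) ^ (3 / 2 : ℝ))) := hfin
    _ ≤ A₄ * ((N : ℝ) ^ δ * 𝒯) + (A₂ * (N : ℝ) ^ δ * 𝒯 + A₃ * ((N : ℝ) ^ δ * 𝒯)) := by gcongr
    _ = (A₂ + A₃ + A₄) * (N : ℝ) ^ δ * 𝒯 := by ring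

end GuthMaynardS3Final

/-! ## §6. The discharge -/

/-- **`zeroDensity_guth_maynard` holds** (Guth–Maynard Theorem 1.2 with Huxley on `[4/5, 1]`):
`N(σ, T) ≪ T^{15(1−σ)/(3+5σ)+o(1)}` uniformly for `σ ≥ 7/10`. Proof: the tree's reduction
`GuthMaynardEnergyBound.zeroDensity_guth_maynard_of_S3` (§§3–6, 11–13 of the paper and
Proposition 11.1) applied to Proposition 10.1 (`GuthMaynardS3Final.S3_bound`).
[cite: GuthMaynard2026, Theorem 1.2] -/
theorem zeroDensity_guth_maynard_holds : zeroDensity_guth_maynard :=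
  GuthMaynardEnergyBound.zeroDensity_guth_maynard_of_S3 fun w hw hsupp hw1 hw01 ε hε δ hδ ↦
    GuthMaynardS3Final.S3_bound w hw hsupp hw1 hw01 ε hε δ hδ

end Literature.NumberTheory.LFunctions

end
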